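import Literature.Probability.RandomPlanarGeometry.SAWTubeCountConventions
import Literature.Probability.RandomPlanarGeometry.SAWTubePolygons
import Literature.Probability.RandomPlanarGeometry.SAWStripInsertionMargin
import Literature.Probability.RandomPlanarGeometry.BDGS2012
import Literature.Probability.RandomPlanarGeometry.BDGS2012CountBoundsProofs
import Literature.Probability.RandomPlanarGeometry.SAWWidePolygonsJoinCount
import Literature.Probability.RandomPlanarGeometry.SAWPolygonClasses
import Literature.Probability.RandomPlanarGeometry.SAWPolygonLowerBoundSharp
import Literature.Probability.RandomPlanarGeometry.SAWPolygonOpening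
import Mathlib.Analysis.SpecialFunctions.Pow.Real
import Mathlib.Order.LiminfLimsup
import Mathlib.Combinatorics.Pigeonhole
import Mathlib.Topology.Order.LiminfLimsup
import HarnessLib

/-!
# Polygons in planar strips: the two-sided locality window for `π(S_L)` and a halved locality constant for `μ(S_L)`
# (Madras–Slade §8.2, Theorems 8.2.1–8.2.2, quantitative forms)

Topic `Literature/Probability/RandomPlanarGeometry` (continues `SAWTubePolygons.lean`: `q̃_N(R) = Zd.tubePolygonCount`,
`π(R) = Zd.tubePolygonRate`; `SAWTubeCount.lean`: `μ(R) = Zd.tubeConnectiveConstant`; `SAWStripInsertionMargin.lean`: the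
explicit margin for (8.2.11) on planar strips; `SAWWidePolygonsJoin(Count).lean`: the DGHM join `J(p, τq)`;
`SAWPolygonOpening.lean`; `SAWPolygonLowerBoundSharp.lean`: Cor. 3.2.5).

Source: N. Madras, G. Slade, *The Self-Avoiding Walk* (Birkhäuser 1993), §8.2: Theorem 8.2.1 (book p. 269:
`μ(R) < μ` (8.2.11), `lim_{T→∞} μ(R[k,T]) = μ` (8.2.12)) and Theorem 8.2.2 (pp. 270–271: `q_N(R)`, `μ_Polygon(R)`;
(b) `μ_Polygon(R) < μ(R)` for `k = 1`). The printed statements are qualitative; this file proves, for the planar strips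
`S_L = R[1,L] = ℤ × {0,…,L}` (`d = 2`, `k = 1`) and with `π(S_L) := limsup_N q̃_{2N+2}(S_L)^{1/(2N+2)}`:

* `StripPolygon.tubePolygonRate_le_tubeConnectiveConstant` — `π(S_L) ≤ μ(S_L)` (the non-strict half of 8.2.2 (b));
  `StripPolygon.one_le_tubePolygonRate` — `1 ≤ π(S_L)` (`L ≥ 1`);
* **`StripPolygon.polygonStripFloor`** — `log(1 + μ^{-(2L+4)})/(L+1) ≤ log μ − log π(S_L)` for every `L ≥ 1`
  (from `π(S_L) ≤ μ(S_L)` and the explicit (8.2.11) margin of `SAWStripInsertionMargin.lean`);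
* **`StripPolygon.polygonStripLocality_explicit`** / `…_eventually` — `log μ − log π(S_L) ≤ (log μ + C⁺/2 + 11)/√L` for every
  `L ≥ 1`, for any constant `C` of Cor. 3.2.5 (`μ^{2M}e^{-C√M} ≤ c_{2M+1}(0,e↓)`, `M ≥ 1`; `C⁺ = max C 0`), and
  `∀ η > 0, ∀ᶠ L, log μ − log π(S_L) ≤ (π√(2/3) + η)/√L` (sharp Cor. 3.2.5); `StripPolygon.polygonStripLocality` (`∃ C`);
* **`StripPolygon.stripLocality_eventually`** — the WALK corollary `∀ η > 0, ∀ᶠ L, log μ − log μ(S_L) ≤ (π√(2/3) + η)/√L`,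
  half the bridge-scheme constant `2π√(2/3)` of `SAWTubeLocalitySharp.lean` (planar case), because the concatenated polygons
  of perimeter `2L` have height `≤ L`; `StripPolygon.stripLocality_explicit` (all `L ≥ 1`).

## Proof (NOT the printed one; lane pcv-sawmu, item POL-LOC, texts a-idea-2 ROUTES §20.8/§20.12)

Everything else is `private` machinery. CEILING: chain `K` normal polygons of `2L` edges of one class
`(y(EN p), y(EN(reflection of p)), x(EN p)) ∈ [0,L]³` (two vertices of an `m`-edge polygon differ by `≤ m/2` in each
coordinate, `two_mul_abs_sub_le_card`, so the pieces fit in `S_L`) with the DGHM join, alternating `p` and its re-normalised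
reflection `τp` so that the east-north rows match and every join shift is horizontal (`chain_facts`: a polygon with `2LK`
edges inside the rows `[0, L]`, east-north vertex tracked exactly; `chain_inj`: decode with `recoverP_dghmJoin` /
`recoverQ_dghmJoin`); encode the chain as a rooted oriented closed walk of `S_L` (`openList` at the plaquette edge below `EN`,
injective through `normalise`); hence `#class^K ≤ q̃_{2LK}(S_L)`, and with the pigeonhole over `(L+1)³` classes,
`|P_{2L}| ≥ c_{2L−1}(0,e↓)/(4L+1)²` (`countAt_le_card_box_mul_card_normPolygons`, (3.2.1)) and Cor. 3.2.5,
`2L·log π(S_L) ≥ (2L−2) log μ − C√(L−1) − 2 log(4L+1) − 3 log(L+1)` along `N = LK − 1`. FLOOR: thin `1 × N` rectangles,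
`q̃_N ≤ c_{N−1}(S_L) ≤ (L+1)4^{N−1}`, Fekete's limit `Zd.tendsto_tubeCount_rpow` along `2N+1`, `limsup` comparison.

Novelty/label (lane referee): explicit two-sided polygon locality window in planar strips and the planar walk-locality
constant `π√(2/3)`; in print qualitative only (M–S Thm 8.2.2 outline; Whittington, LNP 775 §2.9.2). No named facts, no
certificates; axioms standard.
-/



/-! ## Part A: strip polygons — elementary bounds, `1 ≤ π(S_L) ≤ μ(S_L)`, and the FLOOR -/

namespace Literature.Probability.RandomPlanarGeometry.SAW.Zd.StripPolygon

open Filter _root_.Topology Finset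
open Literature.Probability.LatticeModels (Site zdGraph zdGraph_adj_iff)
open Literature.Probability.RandomPlanarGeometry.SAW
open scoped BigOperators

/-- `q̃_N(R) ≤ c_{N-1}(R)`: forget the closing condition. [folklore] -/
private theorem tubePolygonCount_le_tubeCount_pred (d k T N : ℕ) :
    tubePolygonCount d k T N ≤ Zd.tubeCount d k T (N - 1) := by
  classical
  unfold tubePolygonCount tubePolygonPairs Zd.tubeCount
  exact card_filter_le _ _

/-- `#tubeStarts 2 1 L = L + 1`. [folklore] -/
private theorem card_tubeStarts_two_one (L : ℕ) : (Zd.tubeStarts 2 1 L).card = L + 1 := by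
  rw [Zd.tubeStarts, Fintype.card_piFinset, Fin.prod_univ_two]
  simp only [Fin.val_zero, Fin.val_one]
  norm_num [Int.card_Icc]

/-- `c_n(ℤ²) ≤ 4^n`. [folklore] -/
private theorem count_two_le_four_pow (n : ℕ) : Zd.count 2 n ≤ 4 ^ n := by
  cases n with
  | zero =>
    -- `c_0 = 1`
    have h1 : Zd.count 2 0 ≤ Zd.count 2 0 * Zd.count 2 0 := by
      have := Zd.one_le_count 2 0; nlinarith
    have : Zd.count 2 0 = 1 := by
      rw [← Zd.card_saws]
      refine Finset.card_eq_one.2 ⟨fun _ => 0, ?_⟩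
      ext ω
      rw [Zd.mem_saws, Finset.mem_singleton]
      constructor
      · rintro ⟨h0, hend, -, -⟩
        funext i; rw [hend i (Nat.zero_le _), h0]
      · rintro rfl
        exact ⟨rfl, fun _ _ => rfl, fun i hi => absurd hi (Nat.not_lt_zero _), fun _ _ _ _ _ => by
          simp_all⟩
    rw [this]; norm_num
  | succ n =>
    calc Zd.count 2 (n + 1) ≤ 2 * 2 * (2 * 2 - 1) ^ n := Zd.count_succ_le 2 n
      _ ≤ 4 ^ (n + 1) := by
          rw [pow_succ]
          have : (2 * 2 - 1 : ℕ) ^ n ≤ 4 ^ n := Nat.pow_le_pow_left (by norm_num) n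
          nlinarith

/-- `c_n(S_L) ≤ (L+1)·4^n`. [folklore] -/
private theorem tubeCount_two_one_le (L n : ℕ) : Zd.tubeCount 2 1 L n ≤ (L + 1) * 4 ^ n := by
  calc Zd.tubeCount 2 1 L n ≤ (Zd.tubeStarts 2 1 L).card * Zd.count 2 n := Zd.tubeCount_le 2 1 L n
    _ ≤ (L + 1) * 4 ^ n := by
        rw [card_tubeStarts_two_one]
        exact Nat.mul_le_mul_left _ (count_two_le_four_pow n)

/-- The root sequence `u_N = q̃_{2N+2}(S_L)^{1/(2N+2)}`. [folklore] -/
private noncomputable def rootSeq (L N : ℕ) : ℝ :=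
  ((tubePolygonCount 2 1 L (2 * N + 2) : ℝ) ^ (1 / (2 * (N : ℝ) + 2)))

/-- `π(S_L)` is the `limsup` of the root sequence. [folklore] -/
private theorem tubePolygonRate_eq (L : ℕ) : tubePolygonRate 2 1 L = limsup (rootSeq L) atTop := rfl

/-- The root sequence is nonnegative. [folklore] -/
private theorem rootSeq_nonneg (L N : ℕ) : 0 ≤ rootSeq L N :=
  Real.rpow_nonneg (Nat.cast_nonneg _) _

/-- A number `x ≥ 1` raised to an exponent in `[0,1]` is at most `x`; a count in `[0, B·4^{n}]`… here:
`q̃_{2N+2}^{1/(2N+2)} ≤ 4(L+1)`. [folklore] -/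
private theorem rootSeq_le (L N : ℕ) : rootSeq L N ≤ 4 * ((L : ℝ) + 1) := by
  unfold rootSeq
  have hq : (tubePolygonCount 2 1 L (2 * N + 2) : ℝ) ≤ ((L : ℝ) + 1) * 4 ^ (2 * N + 1) := by
    have h := (tubePolygonCount_le_tubeCount_pred 2 1 L (2 * N + 2)).trans (tubeCount_two_one_le L _)
    rw [show 2 * N + 2 - 1 = 2 * N + 1 by omega] at h
    exact_mod_cast h
  have hexp0 : 0 < 1 / (2 * (N : ℝ) + 2) := by positivity
  have hexp1 : 1 / (2 * (N : ℝ) + 2) ≤ 1 := by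
    rw [div_le_one (by positivity)]; linarith [(Nat.cast_nonneg N : (0 : ℝ) ≤ N)]
  -- `(B·4^{2N+1})^{θ} ≤ ((4(L+1))^{2N+2})^{θ} = 4(L+1)`
  have hB : ((L : ℝ) + 1) * 4 ^ (2 * N + 1) ≤ (4 * ((L : ℝ) + 1)) ^ (2 * N + 2) := by
    rw [mul_pow, pow_succ (4 : ℝ) (2 * N + 1)]
    have h1 : (L : ℝ) + 1 ≤ ((L : ℝ) + 1) ^ (2 * N + 2) :=
      le_self_pow₀ (by linarith [(Nat.cast_nonneg L : (0 : ℝ) ≤ L)]) (by omega)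
    have h4 : (0 : ℝ) ≤ 4 ^ (2 * N + 1) := by positivity
    nlinarith
  calc ((tubePolygonCount 2 1 L (2 * N + 2) : ℝ)) ^ (1 / (2 * (N : ℝ) + 2))
      ≤ ((4 * ((L : ℝ) + 1)) ^ (2 * N + 2)) ^ (1 / (2 * (N : ℝ) + 2)) :=
        Real.rpow_le_rpow (Nat.cast_nonneg _) (hq.trans hB) hexp0.le
    _ = 4 * ((L : ℝ) + 1) := by
        rw [← Real.rpow_natCast, ← Real.rpow_mul (by positivity)]
        have : ((2 * N + 2 : ℕ) : ℝ) * (1 / (2 * (N : ℝ) + 2)) = 1 := by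
          push_cast; field_simp
        rw [this, Real.rpow_one]

/-- The root sequence is bounded above (needed for every `limsup` manipulation). [folklore] -/
private theorem isBoundedUnder_rootSeq (L : ℕ) : IsBoundedUnder (· ≤ ·) atTop (rootSeq L) :=
  isBoundedUnder_of ⟨4 * ((L : ℝ) + 1), fun N => rootSeq_le L N⟩

/-- The root sequence is cobounded (it is nonnegative). [folklore] -/
private theorem isCoboundedUnder_rootSeq (L : ℕ) : IsCoboundedUnder (· ≤ ·) atTop (rootSeq L) :=
  isCoboundedUnder_le_of_le atTop fun N => rootSeq_nonneg L N

/-- Lower bounds pass to `π`: if `A ≤ u_N` frequently then `A ≤ π(S_L)`. [folklore] -/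
private theorem le_tubePolygonRate_of_frequently {L : ℕ} {A : ℝ} (h : ∃ᶠ N in atTop, A ≤ rootSeq L N) :
    A ≤ tubePolygonRate 2 1 L := by
  rw [tubePolygonRate_eq]
  exact le_limsup_of_frequently_le h (isBoundedUnder_rootSeq L)

/-! ### `π(S_L) ≤ μ(S_L)` -/

/-- `u_N ≤ c_{2N+1}(S_L)^{1/(2N+1)}`. [folklore] -/
private theorem rootSeq_le_tubeCount_rpow (L N : ℕ) :
    rootSeq L N ≤ (Zd.tubeCount 2 1 L (2 * N + 1) : ℝ) ^ (1 / ((2 * N + 1 : ℕ) : ℝ)) := by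
  unfold rootSeq
  have h1 : (tubePolygonCount 2 1 L (2 * N + 2) : ℝ) ≤ Zd.tubeCount 2 1 L (2 * N + 1) := by
    have h := tubePolygonCount_le_tubeCount_pred 2 1 L (2 * N + 2)
    rw [show 2 * N + 2 - 1 = 2 * N + 1 by omega] at h
    exact_mod_cast h
  have hc1 : (1 : ℝ) ≤ Zd.tubeCount 2 1 L (2 * N + 1) := by
    exact_mod_cast Zd.one_le_tubeCount (d := 2) le_rfl L (2 * N + 1)
  calc ((tubePolygonCount 2 1 L (2 * N + 2) : ℝ)) ^ (1 / (2 * (N : ℝ) + 2))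
      ≤ (Zd.tubeCount 2 1 L (2 * N + 1) : ℝ) ^ (1 / (2 * (N : ℝ) + 2)) :=
        Real.rpow_le_rpow (Nat.cast_nonneg _) h1 (by positivity)
    _ ≤ (Zd.tubeCount 2 1 L (2 * N + 1) : ℝ) ^ (1 / ((2 * N + 1 : ℕ) : ℝ)) := by
        apply Real.rpow_le_rpow_of_exponent_le hc1
        push_cast
        exact one_div_le_one_div_of_le (by positivity) (by linarith)

/-- `c_{2N+1}(S_L)^{1/(2N+1)} → μ(S_L)`. [folklore] -/
private theorem tendsto_tubeCount_rpow_odd (L : ℕ) :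
    Tendsto (fun N : ℕ => (Zd.tubeCount 2 1 L (2 * N + 1) : ℝ) ^ (1 / ((2 * N + 1 : ℕ) : ℝ))) atTop
      (𝓝 (Zd.tubeConnectiveConstant 2 1 L)) := by
  have h := Zd.tendsto_tubeCount_rpow (d := 2) (k := 1) le_rfl L
  have hsub : Tendsto (fun N : ℕ => 2 * N + 1) atTop atTop := by
    refine tendsto_atTop_mono (fun N => ?_) tendsto_id
    show N ≤ 2 * N + 1; omega
  exact h.comp hsub

/-- **`π(S_L) ≤ μ(S_L)`.**
[cite: MadrasSlade1993, §8.2, Theorem 8.2.2 (b) (non-strict half, planar strips)] -/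
theorem tubePolygonRate_le_tubeConnectiveConstant (L : ℕ) :
    tubePolygonRate 2 1 L ≤ Zd.tubeConnectiveConstant 2 1 L := by
  rw [tubePolygonRate_eq, ← (tendsto_tubeCount_rpow_odd L).limsup_eq]
  refine limsup_le_limsup (Eventually.of_forall fun N => rootSeq_le_tubeCount_rpow L N)
    (isCoboundedUnder_rootSeq L) (tendsto_tubeCount_rpow_odd L).isBoundedUnder_le

/-! ### `1 ≤ π(S_L)` for `L ≥ 1`: thin rectangles -/

/-- The thin rectangle walk of length `2N+1`: right along row `0` for `N` steps, up, left along row `1`;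
frozen at `(0,1)` afterwards. [folklore] -/
private def rectWalk (N : ℕ) (i : ℕ) : Site 2 :=
  if i ≤ N then ![(i : ℤ), 0] else if i ≤ 2 * N + 1 then ![((2 * N + 1 - i : ℕ) : ℤ), 1] else ![0, 1]

/-- The bottom row of the thin rectangle. [folklore] -/
private theorem rectWalk_of_le {N i : ℕ} (h : i ≤ N) : rectWalk N i = ![(i : ℤ), 0] := by
  simp [rectWalk, h]

/-- The top row of the thin rectangle. [folklore] -/
private theorem rectWalk_of_gt {N i : ℕ} (h : N < i) (h' : i ≤ 2 * N + 1) :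
    rectWalk N i = ![((2 * N + 1 - i : ℕ) : ℤ), 1] := by
  simp [rectWalk, not_le.2 h, h']

/-- The thin rectangle walk is frozen at `(0,1)` from time `2N+1` on. [folklore] -/
private theorem rectWalk_of_end {N i : ℕ} (h : 2 * N + 1 ≤ i) : rectWalk N i = ![0, 1] := by
  rcases h.eq_or_lt with h | h
  · rw [rectWalk_of_gt (by omega) h.symm.le, ← h]; simp
  · simp [rectWalk, not_le.2 (show N < i by omega), not_le.2 h]

/-- Adjacency of sites differing by a unit vector in one coordinate. [folklore] -/
private theorem adj_of_eq {x y : Site 2} (i : Fin 2) (h : y = x + Pi.single i 1 ∨ x = y + Pi.single i 1) :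
    (zdGraph 2).Adj x y := by
  rw [zdGraph_adj_iff]
  rcases h with h | h
  · exact ⟨i, Or.inl h⟩
  · refine ⟨i, Or.inr ?_⟩; rw [h]

/-- The thin rectangle walk is a `(2N+1)`-step self-avoiding walk from the origin. [folklore] -/
private theorem rectWalk_mem_saws (N : ℕ) : rectWalk N ∈ Zd.saws 2 (2 * N + 1) := by
  refine Zd.mem_saws.2 ⟨by rw [rectWalk_of_le (Nat.zero_le _)]; simp, fun i hi => ?_, fun i hi => ?_, ?_⟩
  · rw [rectWalk_of_end hi, rectWalk_of_end le_rfl]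
  · -- adjacency of consecutive sites
    rcases lt_or_ge i N with h | h
    · rw [rectWalk_of_le h.le, rectWalk_of_le h]
      refine adj_of_eq 0 (Or.inl ?_)
      funext j; fin_cases j <;> simp
    · rcases h.eq_or_lt with h | h
      · subst h
        rw [rectWalk_of_le le_rfl, rectWalk_of_gt (Nat.lt_succ_self _) (by omega),
          show 2 * N + 1 - (N + 1) = N by omega]
        refine adj_of_eq 1 (Or.inl ?_)
        funext j; fin_cases j <;> simp
      · rw [rectWalk_of_gt h (by omega), rectWalk_of_gt (by omega) (by omega)]
        refine adj_of_eq 0 (Or.inr ?_)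
        funext j; fin_cases j
        · simp; omega
        · simp
  · -- injectivity on `[0, 2N+1]`
    intro i hi j hj hij
    simp only [Set.mem_setOf_eq] at hi hj
    rcases le_or_gt i N with h1 | h1 <;> rcases le_or_gt j N with h2 | h2
    · rw [rectWalk_of_le h1, rectWalk_of_le h2] at hij
      have := congrFun hij 0; simp at this; exact_mod_cast this
    · rw [rectWalk_of_le h1, rectWalk_of_gt h2 hj] at hij
      have := congrFun hij 1; simp at this
    · rw [rectWalk_of_gt h1 hi, rectWalk_of_le h2] at hij
      have := congrFun hij 1; simp at this
    · rw [rectWalk_of_gt h1 hi, rectWalk_of_gt h2 hj] at hij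
      have := congrFun hij 0; simp at this; omega

/-- The thin rectangle is a rooted polygon of `S_L` (`L ≥ 1`) with `2N+2 ≥ 4` edges. [folklore] -/
private theorem rectWalk_mem_tubePolygonPairs {L : ℕ} (hL : 1 ≤ L) {N : ℕ} (hN : 1 ≤ N) :
    ((0 : Site 2), rectWalk N) ∈ tubePolygonPairs 2 1 L (2 * N + 2) := by
  classical
  unfold tubePolygonPairs
  rw [Finset.mem_filter, show 2 * N + 2 - 1 = 2 * N + 1 by omega, Zd.mem_tubePairs]
  refine ⟨⟨Zd.zero_mem_tubeStarts 2 1 L, rectWalk_mem_saws N, fun m _ i hi => ?_⟩, by omega, ?_⟩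
  · have hL' : (1 : ℤ) ≤ L := by exact_mod_cast hL
    fin_cases i
    · simp at hi
    · simp only [zero_add]
      rcases le_or_gt m N with h | h
      · rw [rectWalk_of_le h]; simp
      · rcases le_or_gt m (2 * N + 1) with h' | h'
        · rw [rectWalk_of_gt h h']; simp [hL']
        · rw [rectWalk_of_end h'.le]; simp [hL']
  · dsimp only
    rw [rectWalk_of_end le_rfl]
    refine adj_of_eq 1 (Or.inr ?_)
    funext j; fin_cases j <;> simp

/-- `1 ≤ q̃_{2N+2}(S_L)` for `L, N ≥ 1`. [folklore] -/
private theorem one_le_tubePolygonCount {L : ℕ} (hL : 1 ≤ L) {N : ℕ} (hN : 1 ≤ N) :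
    1 ≤ tubePolygonCount 2 1 L (2 * N + 2) :=
  Finset.card_pos.2 ⟨_, rectWalk_mem_tubePolygonPairs hL hN⟩

/-- **`1 ≤ π(S_L)`** for `L ≥ 1`. [folklore] -/
private theorem one_le_tubePolygonRate {L : ℕ} (hL : 1 ≤ L) : 1 ≤ tubePolygonRate 2 1 L := by
  refine le_tubePolygonRate_of_frequently (((eventually_ge_atTop 1).mono fun N hN => ?_).frequently)
  unfold rootSeq
  have : (1 : ℝ) ≤ tubePolygonCount 2 1 L (2 * N + 2) := by exact_mod_cast one_le_tubePolygonCount hL hN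
  exact Real.one_le_rpow this (by positivity)

/-! ### The FLOOR -/

/-- **`PolygonStripFloor`**: `log(1 + μ^{-(2L+4)})/(L+1) ≤ log μ − log π(S_L)` for every `L ≥ 1`, from
`π(S_L) ≤ μ(S_L)` and the tree's X16 margin `Zd.StripInsertion.log_connectiveConstant_sub_log_tubeConnectiveConstant_ge`.
[cite: MadrasSlade1993, §8.2, Theorem 8.2.1, eq. (8.2.11) (quantitative form for polygons in planar strips, this file)] -/
theorem polygonStripFloor (L : ℕ) (hL : 1 ≤ L) :
    Real.log (1 + (Zd.connectiveConstant 2)⁻¹ ^ (2 * L + 4)) / ((L : ℝ) + 1)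
      ≤ Real.log (Zd.connectiveConstant 2) - Real.log (tubePolygonRate 2 1 L) := by
  have hμ : 0 < Zd.connectiveConstant 2 := Zd.connectiveConstant_pos 2
  have hX16 := Zd.StripInsertion.log_connectiveConstant_sub_log_tubeConnectiveConstant_ge L
  have hπ1 := one_le_tubePolygonRate hL
  have hlog : Real.log (tubePolygonRate 2 1 L) ≤ Real.log (Zd.tubeConnectiveConstant 2 1 L) :=
    Real.log_le_log (by linarith) (tubePolygonRate_le_tubeConnectiveConstant L)
  have hconv : (Zd.connectiveConstant 2)⁻¹ ^ (2 * L + 4) = Zd.connectiveConstant 2 ^ (-(2 * (L : ℝ) + 4)) := by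
    rw [show (-(2 * (L : ℝ) + 4)) = -((2 * L + 4 : ℕ) : ℝ) by push_cast; ring, Real.rpow_neg hμ.le,
      Real.rpow_natCast, inv_pow]
  rw [hconv]
  linarith

end Literature.Probability.RandomPlanarGeometry.SAW.Zd.StripPolygon

/-! ## Part B: the alternating DGHM chain of polygons of one class -/

namespace Literature.Probability.RandomPlanarGeometry.SAW.Zd.StripPolygon

open Finset SimpleGraph
open Literature.Probability.LatticeModels (Site zdGraph zdGraph_adj_iff)
open Literature.Probability.RandomPlanarGeometry.SAW
open Literature.Barriers.CriticalPhenomena.SupercriticalSAW (shiftEdges isPolygon_shiftEdges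
  card_shiftEdges mem_shiftEdges_iff shiftEdges_injective)
open Literature.Probability.Percolation.SiteGadgetSystem (vertsOf mem_vertsOf)
open scoped BigOperators

noncomputable section

/-- Two sites of `ℤ²` with equal coordinates are equal. [folklore] -/
private theorem site_ext₂ {v w : Site 2} (h0 : v 0 = w 0) (h1 : v 1 = w 1) : v = w := by
  funext i; fin_cases i <;> assumption

/-! ### Halving: two vertices of an `m`-edge polygon differ by at most `m/2` in each coordinate -/

/-- **`2·|v_i − w_i| ≤ #E`** for two vertices of a polygon `E` of `ℤ²`: both arcs of the cycle between
`v` and `w` change the coordinate by `|v_i − w_i|`.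
[cite: MadrasSlade1993, Definition 3.2.1 (self-avoiding polygons)] -/
theorem two_mul_abs_sub_le_card {E : Finset (Sym2 (Site 2))} (hE : IsPolygon (zdGraph 2) E)
    {v w : Site 2} (hv : v ∈ vertsOf E) (hw : w ∈ vertsOf E) (i : Fin 2) :
    2 * |v i - w i| ≤ E.card := by
  classical
  obtain ⟨u, c, hc, rfl⟩ := hE
  have hlen : (c.length : ℤ) = (c.edges.toFinset.card : ℤ) := by
    rw [List.toFinset_card_of_nodup hc.edges_nodup, Walk.length_edges]
  rw [← hlen]
  have hv' := (mem_vertsOf_iff_mem_support hc).1 hv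
  have hw' := (mem_vertsOf_iff_mem_support hc).1 hw
  -- split `c` at `v`: `c = p₁ ++ p₂`, `p₁ : u → v`, `p₂ : v → u`
  have hspec := c.take_spec hv'
  set p₁ := c.takeUntil v hv' with hp₁
  set p₂ := c.dropUntil v hv' with hp₂
  have hlen12 : c.length = p₁.length + p₂.length := by
    rw [← Walk.length_append, hspec]
  have hw12 : w ∈ p₁.support ∨ w ∈ p₂.support := by
    have : w ∈ (p₁.append p₂).support := by rw [hspec]; exact hw'
    exact (Walk.mem_support_append_iff _ _).1 this
  rcases hw12 with h | h
  · -- `p₁ = q₁ ++ q₂` at `w`; arcs `q₂ : w → v` and `p₂ ++ q₁ : v → w`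
    have hq := p₁.take_spec h
    set q₁ := p₁.takeUntil w h
    set q₂ := p₁.dropUntil w h
    have hl1 : p₁.length = q₁.length + q₂.length := by rw [← Walk.length_append, hq]
    have h1 : |v i - w i| ≤ q₂.length := abs_sub_le_length_of_mem_support q₂ i w q₂.start_mem_support
    have h2 : |w i - v i| ≤ (p₂.append q₁).length :=
      abs_sub_le_length_of_mem_support (p₂.append q₁) i v (Walk.start_mem_support _)
    rw [Walk.length_append] at h2
    rw [abs_sub_comm] at h2
    push_cast [hlen12, hl1] at h1 h2 ⊢
    linarith
  · -- `p₂ = q₁ ++ q₂` at `w`; arcs `q₁ : v → w` and `q₂ ++ p₁ : w → v`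
    have hq := p₂.take_spec h
    set q₁ := p₂.takeUntil w h
    set q₂ := p₂.dropUntil w h
    have hl2 : p₂.length = q₁.length + q₂.length := by rw [← Walk.length_append, hq]
    have h1 : |w i - v i| ≤ q₁.length := abs_sub_le_length_of_mem_support q₁ i v q₁.start_mem_support
    have h2 : |v i - w i| ≤ (q₂.append p₁).length :=
      abs_sub_le_length_of_mem_support (q₂.append p₁) i w (Walk.start_mem_support _)
    rw [Walk.length_append] at h2
    rw [abs_sub_comm] at h1
    push_cast [hlen12, hl2] at h1 h2 ⊢
    linarith

/-! ### Pieces: normal polygons with `2L` edges; their coordinates -/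

section Pieces

variable {L : ℕ} {p : Finset (Sym2 (Site 2))}

/-- A normal `2L`-edge polygon has all its vertices in `[0, L]²`. [folklore] -/
private theorem coord_le_of_mem_normPolygons (hp : p ∈ normPolygons (2 * L)) {v : Site 2} (hv : v ∈ vertsOf p)
    (i : Fin 2) : 0 ≤ v i ∧ v i ≤ L := by
  obtain ⟨hP, hc, hN⟩ := mem_normPolygons.1 hp
  obtain ⟨hpos, ⟨a, ha, ha0⟩, ⟨b, hb, hb0⟩⟩ := hN
  have hx : v 0 ≤ L := by
    have := two_mul_abs_sub_le_card hP hv ha 0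
    rw [ha0, sub_zero, hc] at this
    push_cast at this
    linarith [le_abs_self (v 0)]
  have hy : v 1 ≤ L := by
    have := two_mul_abs_sub_le_card hP hv hb 1
    rw [hb0, sub_zero, hc] at this
    push_cast at this
    linarith [le_abs_self (v 1)]
  fin_cases i
  · exact ⟨(hpos v hv).1, hx⟩
  · exact ⟨(hpos v hv).2, hy⟩

/-- The east-north vertex of the reflection of a normal edge set lies on the column `x = 0`. [folklore] -/
private theorem enV_reflEdges_zero (hN : IsNormal p) (hne : (vertsOf p).Nonempty) : enV (reflEdges 0 p) 0 = 0 := by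
  obtain ⟨hpos, ⟨a, ha, ha0⟩, -⟩ := hN
  have hne' : (vertsOf (reflEdges 0 p)).Nonempty := by
    obtain ⟨v, hv⟩ := hne
    exact ⟨Zd.reflAt 0 0 v, mem_vertsOf_reflEdges.2 (by rw [Zd.reflAt_reflAt]; exact hv)⟩
  have hEN := isEN_enV hne'
  have h1 : Zd.reflAt 0 0 (enV (reflEdges 0 p)) ∈ vertsOf p := mem_vertsOf_reflEdges.1 hEN.1
  have h2 := (hpos _ h1).1
  simp only [Zd.reflAt_apply_same, zero_sub] at h2
  have h3 : Zd.reflAt 0 0 a ∈ vertsOf (reflEdges 0 p) :=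
    mem_vertsOf_reflEdges.2 (by rw [Zd.reflAt_reflAt]; exact ha)
  have h4 := (hEN.2 _ h3).1
  simp only [Zd.reflAt_apply_same, ha0, sub_zero] at h4
  linarith

/-- Rows are reflection invariant: the reflection's east-north row is a row of `p`. [folklore] -/
private theorem enV_reflEdges_one_le (hp : p ∈ normPolygons (2 * L)) :
    0 ≤ enV (reflEdges 0 p) 1 ∧ enV (reflEdges 0 p) 1 ≤ L := by
  obtain ⟨hP, -, -⟩ := mem_normPolygons.1 hp
  have hne := hP.vertsOf_nonempty
  have hne' : (vertsOf (reflEdges 0 p)).Nonempty := by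
    obtain ⟨v, hv⟩ := hne
    exact ⟨Zd.reflAt 0 0 v, mem_vertsOf_reflEdges.2 (by rw [Zd.reflAt_reflAt]; exact hv)⟩
  have h1 : Zd.reflAt 0 0 (enV (reflEdges 0 p)) ∈ vertsOf p := mem_vertsOf_reflEdges.1 (isEN_enV hne').1
  have := coord_le_of_mem_normPolygons hp h1 1
  rwa [Zd.reflAt_apply_of_ne (show (1 : Fin 2) ≠ 0 by decide)] at this

end Pieces

/-! ### The reflected piece `τp`, re-normalised -/

/-- `τp`: the reflection of `p` in the vertical axis, translated back to normal position (by `(x(EN p), 0)`). [folklore] -/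
private def tauN (p : Finset (Sym2 (Site 2))) : Finset (Sym2 (Site 2)) :=
  shiftEdges (siteXY (enV p 0) 0) (reflEdges 0 p)

section Tau

variable {p : Finset (Sym2 (Site 2))}

/-- Reflecting `τp` gives back a translate of `p`. [folklore] -/
private theorem reflEdges_tauN (p : Finset (Sym2 (Site 2))) :
    reflEdges 0 (tauN p) = shiftEdges (siteXY (-(enV p 0)) 0) p := by
  rw [tauN, reflEdges_shiftEdges, reflEdges_reflEdges, mkSite_zero, mkSite_one, zero_sub]

/-- Vertices of `τp`, in terms of the vertices of `p`. [folklore] -/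
private theorem mem_vertsOf_tauN {v : Site 2} :
    v ∈ vertsOf (tauN p) ↔ Zd.reflAt 0 0 (v - siteXY (enV p 0) 0) ∈ vertsOf p := by
  rw [tauN, mem_vertsOf_shiftEdges, mem_vertsOf_reflEdges]

/-- Coordinates of a vertex of `τp`: `(x(EN p) − x, y)` for a vertex `(x, y)` of `p`. [folklore] -/
private theorem mem_vertsOf_tauN' {v : Site 2} :
    v ∈ vertsOf (tauN p) ↔ siteXY (enV p 0 - v 0) (v 1) ∈ vertsOf p := by
  rw [mem_vertsOf_tauN]
  have : Zd.reflAt 0 0 (v - siteXY (enV p 0) 0) = siteXY (enV p 0 - v 0) (v 1) := by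
    refine site_ext₂ ?_ ?_
    · simp only [Zd.reflAt_apply_same, Pi.sub_apply, mkSite_zero]; ring
    · rw [Zd.reflAt_apply_of_ne (show (1 : Fin 2) ≠ 0 by decide), Pi.sub_apply, mkSite_one, mkSite_one, sub_zero]
  rw [this]

/-- `τp` is a polygon with as many edges as `p`. [folklore] -/
private theorem isPolygon_tauN (hP : IsPolygon (zdGraph 2) p) :
    IsPolygon (zdGraph 2) (tauN p) ∧ (tauN p).card = p.card := by
  refine ⟨isPolygon_shiftEdges (isPolygon_reflEdges hP 0) _, ?_⟩
  rw [tauN, card_shiftEdges, card_reflEdges]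

/-- `τp` is normal for normal `p`. [folklore] -/
private theorem isNormal_tauN (hN : IsNormal p) (hne : (vertsOf p).Nonempty) : IsNormal (tauN p) := by
  obtain ⟨hpos, ⟨a, ha, ha0⟩, ⟨b, hb, hb0⟩⟩ := hN
  have hEN := isEN_enV hne
  refine ⟨fun v hv => ?_, ?_, ?_⟩
  · rw [mem_vertsOf_tauN'] at hv
    have h1 := hpos _ hv
    have h2 := (hEN.2 _ hv).1
    simp only [mkSite_zero, mkSite_one] at h1 h2
    exact ⟨by linarith, h1.2⟩
  · refine ⟨siteXY 0 (enV p 1), ?_, mkSite_zero _ _⟩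
    rw [mem_vertsOf_tauN']
    simp only [mkSite_zero, mkSite_one, sub_zero]
    have : siteXY (enV p 0) (enV p 1) = enV p := site_ext₂ (mkSite_zero _ _) (mkSite_one _ _)
    rw [this]; exact hEN.1
  · refine ⟨siteXY (enV p 0 - b 0) (b 1), ?_, by rw [mkSite_one, hb0]⟩
    rw [mem_vertsOf_tauN']
    simp only [mkSite_zero, mkSite_one, sub_sub_cancel]
    have : siteXY (b 0) (b 1) = b := site_ext₂ (mkSite_zero _ _) (mkSite_one _ _)
    rw [this]; exact hb

/-- The east-north vertex of `τp` is `(x(EN p), y(EN(reflection of p)))`. [folklore] -/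
private theorem enV_tauN (hN : IsNormal p) (hne : (vertsOf p).Nonempty) :
    enV (tauN p) = siteXY (enV p 0) (enV (reflEdges 0 p) 1) := by
  have hne' : (vertsOf (reflEdges 0 p)).Nonempty := by
    obtain ⟨v, hv⟩ := hne
    exact ⟨Zd.reflAt 0 0 v, mem_vertsOf_reflEdges.2 (by rw [Zd.reflAt_reflAt]; exact hv)⟩
  have hne'' : (vertsOf (tauN p)).Nonempty := by
    rw [tauN]; exact vertsOf_shiftEdges_nonempty.2 hne'
  have h := (isEN_enV hne').shift (siteXY (enV p 0) 0)
  rw [← tauN] at h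
  have e := (isEN_enV hne'').unique h
  rw [e]
  refine site_ext₂ ?_ ?_
  · rw [Pi.add_apply, mkSite_zero, mkSite_zero, enV_reflEdges_zero hN hne, zero_add]
  · rw [Pi.add_apply, mkSite_one, mkSite_one, add_zero]

/-- The east-north vertex of the reflection of `τp` is `(0, y(EN p))`. [folklore] -/
private theorem enV_reflEdges_tauN (hne : (vertsOf p).Nonempty) :
    enV (reflEdges 0 (tauN p)) = siteXY 0 (enV p 1) := by
  rw [reflEdges_tauN]
  have hne'' : (vertsOf (shiftEdges (siteXY (-enV p 0) 0) p)).Nonempty := vertsOf_shiftEdges_nonempty.2 hne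
  have h := (isEN_enV hne).shift (siteXY (-enV p 0) 0)
  rw [(isEN_enV hne'').unique h]
  refine site_ext₂ ?_ ?_
  · rw [Pi.add_apply, mkSite_zero, mkSite_zero]; ring
  · rw [Pi.add_apply, mkSite_one, mkSite_one, add_zero]

/-- `τp ∈ normPolygons m` for `p ∈ normPolygons m`. [folklore] -/
private theorem tauN_mem_normPolygons {m : ℕ} (hp : p ∈ normPolygons m) : tauN p ∈ normPolygons m := by
  obtain ⟨hP, hc, hN⟩ := mem_normPolygons.1 hp
  obtain ⟨h1, h2⟩ := isPolygon_tauN hP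
  exact mem_normPolygons.2 ⟨h1, h2.trans hc, isNormal_tauN hN hP.vertsOf_nonempty⟩

/-- `p` is recovered from `τp`: `p = normalise (reflEdges 0 (τp))`. [folklore] -/
private theorem normalise_reflEdges_tauN (hN : IsNormal p) : normalise (reflEdges 0 (tauN p)) = p := by
  rw [reflEdges_tauN, normalise_shiftEdges, normalise_eq_self hN]

end Tau

/-! ### One join step with matched east-north rows -/

section Step

variable {E g : Finset (Sym2 (Site 2))}

/-- The translation vector of the copy of `g` in `J(E, τ g)`. [folklore] -/
private def joinShift (E g : Finset (Sym2 (Site 2))) : Site 2 := enV E + ex - Zd.reflAt 0 0 (enV g)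

/-- The copy of `g` in the join is the reflection of `g` translated by `joinShift`. [folklore] -/
private theorem qImage_eq (E g : Finset (Sym2 (Site 2))) : qImage E g = shiftEdges (joinShift E g) (reflEdges 0 g) := rfl

/-- Horizontal component of the join shift. [folklore] -/
private theorem joinShift_zero (E g : Finset (Sym2 (Site 2))) : joinShift E g 0 = enV E 0 + 1 + enV g 0 := by
  simp [joinShift, ex]

/-- Vertical component of the join shift (zero when the east-north rows match). [folklore] -/
private theorem joinShift_one (E g : Finset (Sym2 (Site 2))) : joinShift E g 1 = enV E 1 - enV g 1 := by
  simp [joinShift, ex]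

/-- A vertex of the copy of `g`: `v = (s₀ − x, s₁ + y)` for a vertex `(x, y)` of `g`, `s = joinShift`. [folklore] -/
private theorem mem_vertsOf_qImage_iff {v : Site 2} :
    v ∈ vertsOf (qImage E g) ↔ siteXY (joinShift E g 0 - v 0) (v 1 - joinShift E g 1) ∈ vertsOf g := by
  rw [qImage_eq, mem_vertsOf_shiftEdges, mem_vertsOf_reflEdges]
  have : Zd.reflAt 0 0 (v - joinShift E g) = siteXY (joinShift E g 0 - v 0) (v 1 - joinShift E g 1) := by
    refine site_ext₂ ?_ ?_
    · simp only [Zd.reflAt_apply_same, Pi.sub_apply, mkSite_zero]; ring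
    · rw [Zd.reflAt_apply_of_ne (show (1 : Fin 2) ≠ 0 by decide), Pi.sub_apply, mkSite_one]
  rw [this]

/-- The vertices of the join are those of `E` and of the copy of `g`. [folklore] -/
private theorem vertsOf_dghmJoin_eq (hE : IsPolygon (zdGraph 2) E) (hg : IsPolygon (zdGraph 2) g) :
    vertsOf (dghmJoin E g) = vertsOf E ∪ vertsOf (qImage E g) :=
  Subset.antisymm (vertsOf_dghmJoin_subset hE hg)
    (union_subset (vertsOf_subset_vertsOf_dghmJoin hE) (vertsOf_qImage_subset_vertsOf_dghmJoin hg))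

/-- **The east-north vertex of the join** is the east-north vertex of the copy of `g`:
`EN(J(E, τg)) = EN(reflection of g) + joinShift`. [folklore] -/
private theorem enV_dghmJoin (hE : IsPolygon (zdGraph 2) E) (hg : IsPolygon (zdGraph 2) g) :
    enV (dghmJoin E g) = enV (reflEdges 0 g) + joinShift E g := by
  have hEn := hE.vertsOf_nonempty
  have hgn := hg.vertsOf_nonempty
  have hgn' : (vertsOf (reflEdges 0 g)).Nonempty := by
    obtain ⟨v, hv⟩ := hgn
    exact ⟨Zd.reflAt 0 0 v, mem_vertsOf_reflEdges.2 (by rw [Zd.reflAt_reflAt]; exact hv)⟩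
  have hJn := (isPolygon_dghmJoin hE hg).1.vertsOf_nonempty
  -- `EN` of the copy
  have hq : IsEN (qImage E g) (enV (reflEdges 0 g) + joinShift E g) := by
    rw [qImage_eq]; exact (isEN_enV hgn').shift _
  refine (isEN_enV hJn).unique ⟨?_, fun v hv => ?_⟩
  · exact vertsOf_qImage_subset_vertsOf_dghmJoin hg hq.1
  · rw [vertsOf_dghmJoin_eq hE hg, mem_union] at hv
    rcases hv with hv | hv
    · have h1 := apply_zero_le_of_mem_vertsOf hEn hv
      have h2 := lt_apply_zero_of_mem_vertsOf_qImage (p := E) hgn hq.1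
      exact ⟨by linarith, fun h => absurd h (by linarith)⟩
    · exact hq.2 v hv

end Step

/-! ### Classes of pieces and the alternating chain -/

/-- The class of a piece: `(y(EN p), y(EN(reflection of p)), x(EN p))`. [folklore] -/
private def pieceKey (p : Finset (Sym2 (Site 2))) : ℤ × ℤ × ℤ := (enV p 1, enV (reflEdges 0 p) 1, enV p 0)

/-- The pieces of class `c` among the normal `2L`-edge polygons. [folklore] -/
private noncomputable def pieceClass (L : ℕ) (c : ℤ × ℤ × ℤ) : Finset (Finset (Sym2 (Site 2))) :=
  (normPolygons (2 * L)).filter fun p => pieceKey p = c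

/-- Membership in a piece class. [folklore] -/
private theorem mem_pieceClass {L : ℕ} {c : ℤ × ℤ × ℤ} {p : Finset (Sym2 (Site 2))} :
    p ∈ pieceClass L c ↔ p ∈ normPolygons (2 * L) ∧ pieceKey p = c := by
  unfold pieceClass; rw [mem_filter]

/-- The piece attached at step `j ≥ 1`: `p` itself at odd steps, `τp` at even steps. [folklore] -/
private noncomputable def orient (j : ℕ) (p : Finset (Sym2 (Site 2))) : Finset (Sym2 (Site 2)) :=
  if Even j then tauN p else p

/-- **The alternating chain** `E_0 = f 0`, `E_{i+1} = J(E_i, τ(orient (i+1) (f (i+1))))`. [folklore] -/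
private noncomputable def chain (f : ℕ → Finset (Sym2 (Site 2))) : ℕ → Finset (Sym2 (Site 2))
  | 0 => f 0
  | i + 1 => dghmJoin (chain f i) (orient (i + 1) (f (i + 1)))

/-- The chain starts with the first piece. [folklore] -/
private theorem chain_zero (f : ℕ → Finset (Sym2 (Site 2))) : chain f 0 = f 0 := rfl

/-- One more piece on the chain. [folklore] -/
private theorem chain_succ (f : ℕ → Finset (Sym2 (Site 2))) (i : ℕ) :
    chain f (i + 1) = dghmJoin (chain f i) (orient (i + 1) (f (i + 1))) := rfl

/-- The east-north row of `E_i`: `b` for even `i`, `a` for odd `i`. [folklore] -/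
private def rowAt (b a : ℤ) (i : ℕ) : ℤ := if Even i then b else a

/-- The east-north row alternates. [folklore] -/
private theorem rowAt_succ (b a : ℤ) (i : ℕ) : rowAt b a (i + 1) = rowAt a b i := by
  unfold rowAt
  by_cases h : Even i
  · rw [if_neg (by simpa [Nat.even_add_one] using h), if_pos h]
  · rw [if_pos (by simpa [Nat.even_add_one] using h), if_neg h]

section Chain

variable {L : ℕ} {b a w : ℤ} {f : ℕ → Finset (Sym2 (Site 2))}

/-- Facts about the oriented piece at step `j ≥ 1` of class `(b, a, w)`: it is a normal `2L`-edge polygon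
with `EN`-row `rowAt b a ?`… precisely `y(EN) = rowAt a b j`… (odd `j`: `b`; even `j`: `a`),
`x(EN) = w`, reflection-`EN`-row the other one, and all vertices in `[0, L]²`. [folklore] -/
private theorem orient_facts {j : ℕ} {p : Finset (Sym2 (Site 2))} (hp : p ∈ pieceClass L (b, a, w)) :
    orient j p ∈ normPolygons (2 * L) ∧ enV (orient j p) 0 = w ∧
      enV (orient j p) 1 = rowAt a b j ∧ enV (reflEdges 0 (orient j p)) 1 = rowAt b a j := by
  obtain ⟨hpn, hkey⟩ := mem_pieceClass.1 hp
  simp only [pieceKey, Prod.mk.injEq] at hkey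
  obtain ⟨hb, ha, hw⟩ := hkey
  obtain ⟨hP, hc, hN⟩ := mem_normPolygons.1 hpn
  have hne := hP.vertsOf_nonempty
  unfold orient rowAt
  by_cases hj : Even j
  · simp only [if_pos hj]
    refine ⟨tauN_mem_normPolygons hpn, ?_, ?_, ?_⟩
    · rw [enV_tauN hN hne, mkSite_zero, hw]
    · rw [enV_tauN hN hne, mkSite_one, ha]
    · rw [enV_reflEdges_tauN hne, mkSite_one, hb]
  · simp only [if_neg hj]
    exact ⟨hpn, hw, hb, ha⟩

/-- **Chain invariants.** If `f j ∈ pieceClass L (b,a,w)` for all `j ≤ i`, then `E_i = chain f i` is a polygon with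
`(i+1)·2L` edges, all of whose vertices `v` satisfy `0 ≤ v₀`, `0 ≤ v₁ ≤ L`, which has vertices on both axes
(so it is normal), and whose east-north vertex is `(i(w+1) + w, rowAt b a i)`. [folklore] -/
private theorem chain_facts (hf : ∀ j, f j ∈ pieceClass L (b, a, w)) (i : ℕ) :
    IsPolygon (zdGraph 2) (chain f i) ∧ (chain f i).card = (i + 1) * (2 * L) ∧
      (∀ v ∈ vertsOf (chain f i), 0 ≤ v 0 ∧ 0 ≤ v 1 ∧ v 1 ≤ L) ∧
      (∃ v ∈ vertsOf (chain f i), v 0 = 0) ∧ (∃ v ∈ vertsOf (chain f i), v 1 = 0) ∧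
      enV (chain f i) = siteXY (i * (w + 1) + w) (rowAt b a i) := by
  induction i with
  | zero =>
    rw [chain_zero]
    obtain ⟨hpn, hkey⟩ := mem_pieceClass.1 (hf 0)
    simp only [pieceKey, Prod.mk.injEq] at hkey
    obtain ⟨hb, -, hw⟩ := hkey
    obtain ⟨hP, hc, hN⟩ := mem_normPolygons.1 hpn
    refine ⟨hP, by rw [hc]; ring, fun v hv => ?_, hN.2.1, hN.2.2, ?_⟩
    · have h0 := coord_le_of_mem_normPolygons hpn hv 0
      have h1 := coord_le_of_mem_normPolygons hpn hv 1
      exact ⟨h0.1, h1.1, h1.2⟩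
    · refine site_ext₂ ?_ ?_
      · rw [mkSite_zero, hw]; push_cast; ring
      · rw [mkSite_one]; simp [rowAt, hb]
  | succ i ih =>
    rw [chain_succ]
    obtain ⟨hP, hc, hco, hx0, hy0, hen⟩ := ih
    obtain ⟨hgn, hgw, hgrow, hgrefl⟩ := orient_facts (j := i + 1) (hf (i + 1))
    obtain ⟨hgP, hgc, hgN⟩ := mem_normPolygons.1 hgn
    set g := orient (i + 1) (f (i + 1)) with hg
    have hJ := isPolygon_dghmJoin hP hgP
    -- the shift has no vertical component
    have hs1 : joinShift (chain f i) g 1 = 0 := by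
      rw [joinShift_one, hen, mkSite_one, hgrow, rowAt_succ, sub_self]
    have hs0 : joinShift (chain f i) g 0 = i * (w + 1) + w + 1 + w := by
      rw [joinShift_zero, hen, mkSite_zero, hgw]
    refine ⟨hJ.1, by rw [hJ.2, hc, hgc]; ring, fun v hv => ?_, ?_, ?_, ?_⟩
    · rw [vertsOf_dghmJoin_eq hP hgP, mem_union] at hv
      rcases hv with hv | hv
      · exact hco v hv
      · have hxpos := lt_apply_zero_of_mem_vertsOf_qImage (p := chain f i) hgP.vertsOf_nonempty hv
        rw [hen, mkSite_zero] at hxpos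
        rw [mem_vertsOf_qImage_iff, hs1, sub_zero] at hv
        have h1 := coord_le_of_mem_normPolygons hgn hv 1
        simp only [mkSite_one] at h1
        have hw0 : 0 ≤ w := by
          rw [← hgw]; exact (hgN.1 _ (isEN_enV hgP.vertsOf_nonempty).1).1
        have hi0 : (0 : ℤ) ≤ i * (w + 1) := by positivity
        exact ⟨by linarith, h1.1, h1.2⟩
    · obtain ⟨v, hv, hv0⟩ := hx0
      exact ⟨v, vertsOf_subset_vertsOf_dghmJoin hP hv, hv0⟩
    · obtain ⟨v, hv, hv0⟩ := hy0
      exact ⟨v, vertsOf_subset_vertsOf_dghmJoin hP hv, hv0⟩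
    · rw [enV_dghmJoin hP hgP]
      have hgne := hgP.vertsOf_nonempty
      refine site_ext₂ ?_ ?_
      · rw [Pi.add_apply, hs0, enV_reflEdges_zero hgN hgne, mkSite_zero]; push_cast; ring
      · rw [Pi.add_apply, hs1, hgrefl, mkSite_one, rowAt_succ, add_zero]

/-- `E_i` is normal. [folklore] -/
private theorem isNormal_chain (hf : ∀ j, f j ∈ pieceClass L (b, a, w)) (i : ℕ) : IsNormal (chain f i) := by
  obtain ⟨-, -, hco, hx0, hy0, -⟩ := chain_facts hf i
  exact ⟨fun v hv => ⟨(hco v hv).1, (hco v hv).2.1⟩, hx0, hy0⟩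

/-- **The chain determines its pieces** (decode the last join with `recoverP`/`recoverQ` at the known
column of `EN(E_i)`, then induct). [folklore] -/
private theorem chain_inj {f f' : ℕ → Finset (Sym2 (Site 2))} (hf : ∀ j, f j ∈ pieceClass L (b, a, w))
    (hf' : ∀ j, f' j ∈ pieceClass L (b, a, w)) {i : ℕ} (h : chain f i = chain f' i) :
    ∀ j ≤ i, f j = f' j := by
  induction i with
  | zero => intro j hj; rw [Nat.le_zero.1 hj]; exact h
  | succ i ih =>
    -- decode the last step
    obtain ⟨hP, -, -, -, -, hen⟩ := chain_facts hf i
    obtain ⟨hP', -, -, -, -, hen'⟩ := chain_facts hf' i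
    obtain ⟨hgn, -, -, -⟩ := orient_facts (j := i + 1) (hf (i + 1))
    obtain ⟨hgn', -, -, -⟩ := orient_facts (j := i + 1) (hf' (i + 1))
    obtain ⟨hgP, -, hgN⟩ := mem_normPolygons.1 hgn
    obtain ⟨hgP', -, hgN'⟩ := mem_normPolygons.1 hgn'
    have hEE : chain f i = chain f' i := by
      have h1 := recoverP_dghmJoin hP hgP (isNormal_chain hf i) 0
      have h2 := recoverP_dghmJoin hP' hgP' (isNormal_chain hf' i) 0
      rw [shiftEdges_zero, add_zero] at h1 h2
      change recoverP (chain f (i + 1)) (enV (chain f i)) = chain f i at h1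
      change recoverP (chain f' (i + 1)) (enV (chain f' i)) = chain f' i at h2
      rw [← h1, ← h2, h, hen, hen']
    have hgg : orient (i + 1) (f (i + 1)) = orient (i + 1) (f' (i + 1)) := by
      have h1 := recoverQ_dghmJoin hP hgP hgN 0
      have h2 := recoverQ_dghmJoin hP' hgP' hgN' 0
      rw [shiftEdges_zero, add_zero] at h1 h2
      change recoverQ (chain f (i + 1)) (enV (chain f i)) = _ at h1
      change recoverQ (chain f' (i + 1)) (enV (chain f' i)) = _ at h2
      rw [← h1, ← h2, h, hen, hen']
    intro j hj
    rcases Nat.lt_or_ge j (i + 1) with hj' | hj'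
    · exact ih hEE j (by omega)
    · have hji : j = i + 1 := le_antisymm hj hj'
      subst hji
      -- un-orient
      have hN1 := (mem_normPolygons.1 (mem_pieceClass.1 (hf (i + 1))).1).2.2
      have hN2 := (mem_normPolygons.1 (mem_pieceClass.1 (hf' (i + 1))).1).2.2
      unfold orient at hgg
      by_cases he : Even (i + 1)
      · rw [if_pos he, if_pos he] at hgg
        rw [← normalise_reflEdges_tauN hN1, ← normalise_reflEdges_tauN hN2, hgg]
      · rwa [if_neg he, if_neg he] at hgg

end Chain

end

end Literature.Probability.RandomPlanarGeometry.SAW.Zd.StripPolygon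

/-! ## Part C: polygons in the strip as rooted oriented closed walks; the counting inequality -/

namespace Literature.Probability.RandomPlanarGeometry.SAW.Zd.StripPolygon

open Filter _root_.Topology Finset SimpleGraph
open Literature.Probability.LatticeModels (Site zdGraph zdGraph_adj_iff)
open Literature.Probability.RandomPlanarGeometry.SAW
open Literature.Barriers.CriticalPhenomena.SupercriticalSAW (shiftEdges isPolygon_shiftEdges
  card_shiftEdges mem_shiftEdges_iff shiftEdges_injective)
open Literature.Probability.Percolation.SiteGadgetSystem (vertsOf mem_vertsOf)
open scoped BigOperators

noncomputable section

/-! ### Index form of `pairEdges` -/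

/-- The consecutive pairs of a list, by index. [folklore] -/
private theorem mem_pairEdges_iff_getElem {V : Type*} {l : List V} {e : Sym2 V} :
    e ∈ pairEdges l ↔ ∃ (i : ℕ) (h : i + 1 < l.length), e = s(l[i], l[i + 1]) := by
  induction l with
  | nil => simp
  | cons a l ih =>
    cases l with
    | nil => simp
    | cons b l =>
      rw [pairEdges_cons_cons, List.mem_cons, ih]
      constructor
      · rintro (rfl | ⟨i, hi, rfl⟩)
        · exact ⟨0, by simp, by simp⟩
        · exact ⟨i + 1, by simpa using hi, by simp⟩
      · rintro ⟨i, hi, rfl⟩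
        cases i with
        | zero => exact Or.inl (by simp)
        | succ i => exact Or.inr ⟨i, by simpa using hi, by simp⟩

/-! ### The opened polygon as a vertex function -/

section Encode

variable {E : Finset (Sym2 (Site 2))}

/-- The vertex list of the polygon `E` opened at the west side `{EN, EN − e₁}` of the plaquette at `EN`. [folklore] -/
private def polyList (E : Finset (Sym2 (Site 2))) : List (Site 2) := openList (zdGraph 2) E (enV E) (enV E - ey)

/-- The `i`-th vertex of the opened polygon (junk `0` past the end). [folklore] -/
private def polyFun (E : Finset (Sym2 (Site 2))) (i : ℕ) : Site 2 := (polyList E).getD i 0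

/-- **The encoding**: root on the vertical axis through `EN`, translate so the root has `x = 0`; the
oriented closed walk of `#E − 1` steps follows the opened polygon. [folklore] -/
private def encode (n : ℕ) (E : Finset (Sym2 (Site 2))) : Site 2 × (ℕ → Site 2) :=
  (Zd.vproj 1 (enV E), fun i => polyFun E (min i (n - 1)) - enV E)

/-- A polygon uses the edge below its east-north vertex. [folklore] -/
private theorem edgeEN_mem (hE : IsPolygon (zdGraph 2) E) : s(enV E, enV E - ey) ∈ E :=
  edge_down_mem_of_isEN hE (isEN_enV hE.vertsOf_nonempty)

/-- The specification of the opened list. [folklore] -/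
private theorem polyList_spec (hE : IsPolygon (zdGraph 2) E) :
    (polyList E).IsChain (zdGraph 2).Adj ∧ (polyList E).Nodup ∧ (polyList E).head? = some (enV E) ∧
      (polyList E).getLast? = some (enV E - ey) ∧ (polyList E).length = E.card ∧ 3 ≤ E.card ∧
      (pairEdges (polyList E)).toFinset = E.erase s(enV E, enV E - ey) := by
  have h := openList_spec hE (edgeEN_mem hE)
  exact ⟨h.1, h.2.1, h.2.2.1, h.2.2.2.1, h.2.2.2.2.1, h.2.2.2.2.2.1, h.2.2.2.2.2.2.1⟩

/-- The opened polygon lists all `#E` vertices. [folklore] -/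
private theorem length_polyList (hE : IsPolygon (zdGraph 2) E) : (polyList E).length = E.card := (polyList_spec hE).2.2.2.2.1

/-- The vertex function reads the opened list. [folklore] -/
private theorem polyFun_eq (hE : IsPolygon (zdGraph 2) E) {i : ℕ} (hi : i < E.card) :
    polyFun E i = (polyList E)[i]'(by rw [length_polyList hE]; exact hi) := by
  unfold polyFun
  rw [List.getD_eq_getElem]

/-- The opened polygon starts at `EN`. [folklore] -/
private theorem polyFun_zero (hE : IsPolygon (zdGraph 2) E) : polyFun E 0 = enV E := by
  have h3 := (polyList_spec hE).2.2.2.2.2.1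
  rw [polyFun_eq hE (by omega)]
  have h := (polyList_spec hE).2.2.1
  rw [List.head?_eq_getElem?, List.getElem?_eq_getElem (by rw [length_polyList hE]; omega)] at h
  exact Option.some.inj h

/-- The opened polygon ends at `EN − e₁`. [folklore] -/
private theorem polyFun_last (hE : IsPolygon (zdGraph 2) E) : polyFun E (E.card - 1) = enV E - ey := by
  have h3 := (polyList_spec hE).2.2.2.2.2.1
  rw [polyFun_eq hE (by omega)]
  have h := (polyList_spec hE).2.2.2.1
  rw [List.getLast?_eq_getElem?, List.getElem?_eq_getElem (by rw [length_polyList hE]; omega)] at h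
  simp only [length_polyList hE] at h
  exact Option.some.inj h

/-- Consecutive vertices of the opened polygon are adjacent. [folklore] -/
private theorem polyFun_adj (hE : IsPolygon (zdGraph 2) E) {i : ℕ} (hi : i + 1 < E.card) :
    (zdGraph 2).Adj (polyFun E i) (polyFun E (i + 1)) := by
  rw [polyFun_eq hE (by omega), polyFun_eq hE hi]
  exact List.isChain_iff_getElem.1 (polyList_spec hE).1 i (by rw [length_polyList hE]; exact hi)

/-- The opened polygon is self-avoiding. [folklore] -/
private theorem polyFun_injOn (hE : IsPolygon (zdGraph 2) E) : Set.InjOn (polyFun E) {i | i ≤ E.card - 1} := by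
  intro i hi j hj hij
  have h3 := (polyList_spec hE).2.2.2.2.2.1
  simp only [Set.mem_setOf_eq] at hi hj
  rw [polyFun_eq hE (by omega), polyFun_eq hE (by omega)] at hij
  exact ((polyList_spec hE).2.1.getElem_inj_iff).1 hij

/-- Every listed vertex is a vertex of the polygon. [folklore] -/
private theorem polyFun_mem_vertsOf (hE : IsPolygon (zdGraph 2) E) {i : ℕ} (hi : i < E.card) : polyFun E i ∈ vertsOf E := by
  have hmem : polyFun E i ∈ polyList E := by rw [polyFun_eq hE hi]; exact List.getElem_mem _
  obtain ⟨e, he, hwe⟩ := exists_mem_of_mem_openList hE (edgeEN_mem hE) hmem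
  exact mem_vertsOf.2 ⟨e, he, hwe⟩

/-- The edges of `E` by index: `E = {s(v_{n-1}, v_0)} ∪ {s(v_i, v_{i+1}) : i < n-1}`. [folklore] -/
private theorem eq_edges_polyFun (hE : IsPolygon (zdGraph 2) E) :
    E = insert s(polyFun E (E.card - 1), polyFun E 0)
      ((Finset.range (E.card - 1)).image fun i => s(polyFun E i, polyFun E (i + 1))) := by
  have h3 := (polyList_spec hE).2.2.2.2.2.1
  have hpe := (polyList_spec hE).2.2.2.2.2.2
  rw [polyFun_last hE, polyFun_zero hE, Sym2.eq_swap]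
  have : ((Finset.range (E.card - 1)).image fun i => s(polyFun E i, polyFun E (i + 1))) =
      (pairEdges (polyList E)).toFinset := by
    ext e
    rw [Finset.mem_image, List.mem_toFinset, mem_pairEdges_iff_getElem]
    constructor
    · rintro ⟨i, hi, rfl⟩
      rw [Finset.mem_range] at hi
      exact ⟨i, by rw [length_polyList hE]; omega, by rw [polyFun_eq hE (by omega), polyFun_eq hE (by omega)]⟩
    · rintro ⟨i, hi, rfl⟩
      rw [length_polyList hE] at hi
      exact ⟨i, Finset.mem_range.2 (by omega), by rw [polyFun_eq hE (by omega), polyFun_eq hE (by omega)]⟩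
  rw [this, hpe, Finset.insert_erase (edgeEN_mem hE)]

/-- `-e₁` is the tree's `eDown`. [folklore] -/
private theorem neg_ey_eq_eDown : -ey = Zd.eDown := by
  funext i; fin_cases i <;> simp [ey, Zd.eDown]

/-- **The encoding lands in the rooted polygons of the strip** when `E` has its rows in `[0, L]`. [folklore] -/
private theorem encode_mem (hE : IsPolygon (zdGraph 2) E) {L : ℕ} (hrows : ∀ v ∈ vertsOf E, 0 ≤ v 1 ∧ v 1 ≤ L) :
    encode E.card E ∈ tubePolygonPairs 2 1 L E.card := by
  classical
  have h3 := (polyList_spec hE).2.2.2.2.2.1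
  have hne := hE.vertsOf_nonempty
  set n := E.card with hn
  unfold tubePolygonPairs encode
  rw [Finset.mem_filter, Zd.mem_tubePairs]
  dsimp only
  refine ⟨⟨?_, ?_, fun m hm => ?_⟩, h3, ?_⟩
  · -- the root is a starting site
    refine Zd.vproj_mem_tubeStarts (fun i hi => ?_)
    have hi1 : i = 1 := by ext; have := i.isLt; simp only [Fin.val_one]; omega
    subst hi1
    exact hrows _ (isEN_enV hne).1
  · -- the translated opened polygon is a self-avoiding walk of `n-1` steps
    refine Zd.mem_saws.2 ⟨by simp [polyFun_zero hE], fun i hi => by rw [min_eq_right hi, min_self], fun i hi => ?_, ?_⟩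
    · rw [min_eq_left hi.le, min_eq_left (by omega), Zd.zdGraph_adj_sub_right]
      exact polyFun_adj hE (by omega)
    · intro i hi j hj hij
      simp only [Set.mem_setOf_eq] at hi hj
      dsimp only at hij
      rw [min_eq_left hi, min_eq_left hj] at hij
      exact polyFun_injOn hE hi hj (sub_left_injective hij)
  · -- rows stay in `[0, L]`
    rw [Zd.inTube_vproj_add_iff, add_sub_cancel]
    intro i hi
    have hi1 : i = 1 := by ext; have := i.isLt; simp only [Fin.val_one]; omega
    subst hi1
    exact hrows _ (polyFun_mem_vertsOf hE (by omega))
  · -- the closing edge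
    show (zdGraph 2).Adj (polyFun E (min (n - 1) (n - 1)) - enV E) 0
    rw [min_self, polyFun_last hE, sub_sub_cancel_left, neg_ey_eq_eDown]
    exact adj_eDown_zero

/-- The edge set traced by a rooted closed walk `(a, υ)` of `n` edges. [folklore] -/
private def decodeSet (n : ℕ) (q : Site 2 × (ℕ → Site 2)) : Finset (Sym2 (Site 2)) :=
  insert s(q.1 + q.2 (n - 1), q.1 + q.2 0) ((Finset.range (n - 1)).image fun i => s(q.1 + q.2 i, q.1 + q.2 (i + 1)))

/-- Decoding: the traced edge set of the encoding is a translate of `E`. [folklore] -/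
private theorem decodeSet_encode (hE : IsPolygon (zdGraph 2) E) :
    decodeSet E.card (encode E.card E) = shiftEdges (Zd.vproj 1 (enV E) - enV E) E := by
  have h3 := (polyList_spec hE).2.2.2.2.2.1
  set t : Site 2 := Zd.vproj 1 (enV E) - enV E with ht
  have key : ∀ i, i ≤ E.card - 1 → Zd.vproj 1 (enV E) + (polyFun E (min i (E.card - 1)) - enV E) = polyFun E i + t := by
    intro i hi; rw [min_eq_left hi, ht]; abel
  conv_rhs => rw [eq_edges_polyFun hE]
  unfold decodeSet encode
  simp only []
  rw [shiftEdges_insert, shiftEdges, Finset.image_image, key _ le_rfl, key 0 (Nat.zero_le _), Sym2.map_mk]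
  congr 1
  refine Finset.image_congr fun i hi => ?_
  rw [Finset.mem_coe, Finset.mem_range] at hi
  simp only [Function.comp_apply, Sym2.map_mk]
  rw [key i (by omega), key (i + 1) (by omega)]

/-- **The encoding is injective on normal polygons with `n` edges.** [folklore] -/
private theorem encode_injOn (n : ℕ) :
    Set.InjOn (encode n) {E | IsPolygon (zdGraph 2) E ∧ E.card = n ∧ IsNormal E} := by
  rintro E ⟨hE, hEn, hEN⟩ E' ⟨hE', hE'n, hE'N⟩ h
  have h1 := decodeSet_encode hE
  have h2 := decodeSet_encode hE'
  rw [hEn] at h1; rw [hE'n] at h2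
  have : shiftEdges (Zd.vproj 1 (enV E) - enV E) E = shiftEdges (Zd.vproj 1 (enV E') - enV E') E' := by
    rw [← h1, ← h2, h]
  have := congrArg normalise this
  rwa [normalise_shiftEdges, normalise_shiftEdges, normalise_eq_self hEN, normalise_eq_self hE'N] at this

end Encode

/-! ### Counting: `|class|^K ≤ q̃_{2LK}(S_L)` -/

section Count

variable {L : ℕ}

/-- Extend a `K`-tuple of pieces to a sequence (constant beyond `K`; the value `f 0` keeps it in the class). [folklore] -/
private def extendSeq {K : ℕ} (hK : 0 < K) (f : Fin K → Finset (Sym2 (Site 2))) (i : ℕ) : Finset (Sym2 (Site 2)) :=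
  if h : i < K then f ⟨i, h⟩ else f ⟨0, hK⟩

/-- The extended sequence stays in the class. [folklore] -/
private theorem extendSeq_mem {K : ℕ} (hK : 0 < K) {c : ℤ × ℤ × ℤ} {f : Fin K → Finset (Sym2 (Site 2))}
    (hf : ∀ j, f j ∈ pieceClass L c) (i : ℕ) : extendSeq hK f i ∈ pieceClass L c := by
  unfold extendSeq; split_ifs <;> exact hf _

/-- **`|pieceClass L c|^K ≤ q̃_{K·2L}(S_L)`**: chain `K` pieces of one class and encode. [folklore] -/
private theorem card_pieceClass_pow_le {K : ℕ} (hK : 1 ≤ K) (c : ℤ × ℤ × ℤ) :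
    (pieceClass L c).card ^ K ≤ tubePolygonCount 2 1 L (K * (2 * L)) := by
  classical
  obtain ⟨b, a, w⟩ := c
  have hK0 : 0 < K := hK
  set F : (Fin K → Finset (Sym2 (Site 2))) → Site 2 × (ℕ → Site 2) :=
    fun f => encode (K * (2 * L)) (chain (extendSeq hK0 f) (K - 1)) with hF
  have hfacts : ∀ f ∈ Fintype.piFinset (fun _ : Fin K => pieceClass L (b, a, w)),
      IsPolygon (zdGraph 2) (chain (extendSeq hK0 f) (K - 1)) ∧
      (chain (extendSeq hK0 f) (K - 1)).card = K * (2 * L) ∧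
      (∀ v ∈ vertsOf (chain (extendSeq hK0 f) (K - 1)), 0 ≤ v 0 ∧ 0 ≤ v 1 ∧ v 1 ≤ L) ∧
      IsNormal (chain (extendSeq hK0 f) (K - 1)) := by
    intro f hf
    rw [Fintype.mem_piFinset] at hf
    have hmem := extendSeq_mem hK0 hf
    obtain ⟨hP, hc, hco, -, -, -⟩ := chain_facts hmem (K - 1)
    rw [Nat.sub_add_cancel hK] at hc
    exact ⟨hP, hc, hco, isNormal_chain hmem (K - 1)⟩
  have hcard : (Fintype.piFinset fun _ : Fin K => pieceClass L (b, a, w)).card = (pieceClass L (b, a, w)).card ^ K := by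
    rw [Fintype.card_piFinset, Finset.prod_const, Finset.card_univ, Fintype.card_fin]
  rw [← hcard, tubePolygonCount]
  refine Finset.card_le_card_of_injOn F (fun f hf => ?_) (fun f hf f' hf' hff' => ?_)
  · obtain ⟨hP, hc, hco, -⟩ := hfacts f (Finset.mem_coe.1 hf)
    have := encode_mem hP (L := L) (fun v hv => ⟨(hco v hv).2.1, (hco v hv).2.2⟩)
    rw [hc] at this
    exact this
  · obtain ⟨hP, hc, -, hN⟩ := hfacts f (Finset.mem_coe.1 hf)
    obtain ⟨hP', hc', -, hN'⟩ := hfacts f' (Finset.mem_coe.1 hf')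
    have hEE := encode_injOn (K * (2 * L)) ⟨hP, hc, hN⟩ ⟨hP', hc', hN'⟩ hff'
    have hf1 := Fintype.mem_piFinset.1 (Finset.mem_coe.1 hf)
    have hf1' := Fintype.mem_piFinset.1 (Finset.mem_coe.1 hf')
    have hall := chain_inj (extendSeq_mem hK0 hf1) (extendSeq_mem hK0 hf1') hEE
    funext j
    have := hall j.val (by omega)
    simpa [extendSeq, j.isLt] using this

end Count

end

end Literature.Probability.RandomPlanarGeometry.SAW.Zd.StripPolygon

/-! ## Part D: pigeonhole over classes, Cor. 3.2.5, limsup extraction — `PolygonStripLocality` -/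

namespace Literature.Probability.RandomPlanarGeometry.SAW.Zd.StripPolygon

open Filter _root_.Topology Finset SimpleGraph
open Literature.Probability.LatticeModels (Site zdGraph zdGraph_adj_iff)
open Literature.Probability.RandomPlanarGeometry.SAW
open Literature.Barriers.CriticalPhenomena.SupercriticalSAW (shiftEdges isPolygon_shiftEdges
  card_shiftEdges mem_shiftEdges_iff shiftEdges_injective)
open Literature.Probability.Percolation.SiteGadgetSystem (vertsOf mem_vertsOf)
open scoped BigOperators

noncomputable section

/-! ### The keys live in `[0, L]³` -/

/-- The possible keys of normal `2L`-edge polygons. [folklore] -/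
private def keySet (L : ℕ) : Finset (ℤ × ℤ × ℤ) :=
  Finset.Icc (0 : ℤ) L ×ˢ (Finset.Icc (0 : ℤ) L ×ˢ Finset.Icc (0 : ℤ) L)

/-- There are `(L+1)³` keys. [folklore] -/
private theorem card_keySet (L : ℕ) : (keySet L).card = (L + 1) ^ 3 := by
  rw [keySet, Finset.card_product, Finset.card_product, Int.card_Icc]
  have : ((L : ℤ) + 1 - 0).toNat = L + 1 := by
    rw [sub_zero, show (L : ℤ) + 1 = ((L + 1 : ℕ) : ℤ) by push_cast; ring, Int.toNat_natCast]
  rw [this]; ring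

/-- The key of a normal `2L`-gon lies in `[0,L]³`. [folklore] -/
private theorem pieceKey_mem_keySet {L : ℕ} {p : Finset (Sym2 (Site 2))} (hp : p ∈ normPolygons (2 * L)) :
    pieceKey p ∈ keySet L := by
  obtain ⟨hP, -, -⟩ := mem_normPolygons.1 hp
  have hen := (isEN_enV hP.vertsOf_nonempty).1
  have h0 := coord_le_of_mem_normPolygons hp hen 0
  have h1 := coord_le_of_mem_normPolygons hp hen 1
  have h2 := enV_reflEdges_one_le hp
  simp only [keySet, pieceKey, Finset.mem_product, Finset.mem_Icc]
  exact ⟨⟨h1.1, h1.2⟩, ⟨h2.1, h2.2⟩, ⟨h0.1, h0.2⟩⟩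

/-- **Pigeonhole**: some class holds at least `|P_{2L}|/(L+1)³` polygons. [folklore] -/
private theorem exists_large_class (L : ℕ) :
    ∃ c, ((normPolygons (2 * L)).card : ℝ) / ((L : ℝ) + 1) ^ 3 ≤ (pieceClass L c).card := by
  classical
  have hne : (keySet L).Nonempty := ⟨(0, 0, 0), by simp [keySet]⟩
  have ht : (keySet L).card • (((normPolygons (2 * L)).card : ℝ) / ((L : ℝ) + 1) ^ 3) ≤
      ((normPolygons (2 * L)).card : ℝ) := by
    rw [nsmul_eq_mul, card_keySet]
    push_cast
    rw [mul_div_cancel₀ _ (by positivity)]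
  obtain ⟨c, -, hc⟩ := Finset.exists_le_card_fiber_of_nsmul_le_card_of_maps_to
    (fun p hp => pieceKey_mem_keySet hp) hne ht
  exact ⟨c, by simpa [pieceClass] using hc⟩

/-! ### From chains to the rate: `|class|^{1/(2L)} ≤ π(S_L)` -/

/-- For `L ≥ 1`: `(#pieceClass L c)^{1/(2L)} ≤ π(S_L)`. [folklore] -/
private theorem rpow_card_pieceClass_le_rate {L : ℕ} (hL : 1 ≤ L) (c : ℤ × ℤ × ℤ) :
    ((pieceClass L c).card : ℝ) ^ (1 / (2 * (L : ℝ))) ≤ tubePolygonRate 2 1 L := by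
  refine le_tubePolygonRate_of_frequently (frequently_atTop.2 fun K₀ => ⟨L * (K₀ + 1) - 1, ?_, ?_⟩)
  · have : K₀ + 1 ≤ L * (K₀ + 1) := Nat.le_mul_of_pos_left _ hL
    omega
  · set K := K₀ + 1 with hK
    have hK1 : 1 ≤ K := by omega
    have hLK : 1 ≤ L * K := Nat.one_le_iff_ne_zero.2 (Nat.mul_ne_zero (by omega) (by omega))
    unfold rootSeq
    have e1 : 2 * (L * K - 1) + 2 = K * (2 * L) := by
      zify [hLK]; ring
    have e2 : (2 * ((L * K - 1 : ℕ) : ℝ) + 2) = (K : ℝ) * (2 * (L : ℝ)) := by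
      have : ((L * K - 1 : ℕ) : ℝ) = (L : ℝ) * K - 1 := by
        rw [Nat.cast_sub hLK]; push_cast; ring
      rw [this]; ring
    rw [e1, e2]
    have hcount : ((pieceClass L c).card : ℝ) ^ K ≤ tubePolygonCount 2 1 L (K * (2 * L)) := by
      exact_mod_cast card_pieceClass_pow_le hK1 c
    have hL0 : (0 : ℝ) < L := by exact_mod_cast hL
    have hK0 : (0 : ℝ) < K := by exact_mod_cast hK1
    calc ((pieceClass L c).card : ℝ) ^ (1 / (2 * (L : ℝ)))
        = ((((pieceClass L c).card : ℝ) ^ K) ^ (1 / ((K : ℝ) * (2 * (L : ℝ))))) := by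
          rw [← Real.rpow_natCast, ← Real.rpow_mul (Nat.cast_nonneg _)]
          congr 1
          field_simp
      _ ≤ (tubePolygonCount 2 1 L (K * (2 * L)) : ℝ) ^ (1 / ((K : ℝ) * (2 * (L : ℝ)))) :=
          Real.rpow_le_rpow (by positivity) hcount (by positivity)

/-! ### The lower bound on the number of normal `2L`-gons (Cor. 3.2.5 and (3.2.1)) -/

/-- `c_{2L-1}(0, e↓) ≤ (4L+1)² · |P_{2L}|` for `L ≥ 2`. [folklore] -/
private theorem countAt_le_card_normPolygons {L : ℕ} (hL : 2 ≤ L) :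
    (Zd.countAt 2 (2 * L - 1) Zd.eDown : ℝ) ≤ (4 * (L : ℝ) + 1) ^ 2 * (normPolygons (2 * L)).card := by
  have h := countAt_le_card_box_mul_card_normPolygons adj_eDown_zero (n := 2 * L - 1) (by omega)
  rw [show 2 * L - 1 + 1 = 2 * L by omega] at h
  have h' : (Zd.countAt 2 (2 * L - 1) Zd.eDown : ℝ) ≤ ((2 * (2 * L) + 1) ^ 2 * (normPolygons (2 * L)).card : ℕ) := by
    exact_mod_cast h
  refine h'.trans (le_of_eq ?_)
  push_cast; ring

/-- **The explicit lower bound on `log π(S_L)`** for `L ≥ 2`, given the constant `C` of Cor. 3.2.5: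
`(2L) log π(S_L) ≥ (2L−2) log μ − C√(L−1) − 2 log(4L+1) − 3 log(L+1)`. [folklore] -/
private theorem log_rate_ge {C : ℝ} {L : ℕ} (hL : 2 ≤ L)
    (hM : Zd.connectiveConstant 2 ^ (2 * (L - 1)) * Real.exp (-(C * Real.sqrt ((L - 1 : ℕ) : ℝ))) ≤
      (Zd.countAt 2 (2 * L - 1) Zd.eDown : ℝ)) :
    ((2 * (L : ℝ) - 2) * Real.log (Zd.connectiveConstant 2) - C * Real.sqrt ((L : ℝ) - 1)
        - 2 * Real.log (4 * (L : ℝ) + 1) - 3 * Real.log ((L : ℝ) + 1)) / (2 * (L : ℝ))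
      ≤ Real.log (tubePolygonRate 2 1 L) := by
  have hμ : 0 < Zd.connectiveConstant 2 := Zd.connectiveConstant_pos 2
  have hL1 : 1 ≤ L := by omega
  have hL0 : (0 : ℝ) < L := by exact_mod_cast (show 0 < L by omega)
  -- the class
  obtain ⟨c, hc⟩ := exists_large_class L
  have hrate := rpow_card_pieceClass_le_rate hL1 c
  -- the count of polygons
  have hP := countAt_le_card_normPolygons hL
  set P : ℝ := ((normPolygons (2 * L)).card : ℝ) with hPdef
  set A : ℝ := Zd.connectiveConstant 2 ^ (2 * (L - 1)) * Real.exp (-(C * Real.sqrt ((L - 1 : ℕ) : ℝ))) with hA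
  have hA0 : 0 < A := by positivity
  have hApoly : A / ((4 * (L : ℝ) + 1) ^ 2 * ((L : ℝ) + 1) ^ 3) ≤ (pieceClass L c).card := by
    refine le_trans ?_ hc
    rw [div_le_div_iff₀ (by positivity) (by positivity)]
    have := hM.trans hP
    nlinarith [this, show (0:ℝ) < ((L : ℝ) + 1) ^ 3 by positivity]
  have hB0 : 0 < A / ((4 * (L : ℝ) + 1) ^ 2 * ((L : ℝ) + 1) ^ 3) := by positivity
  -- `π ≥ (A/poly)^{1/(2L)}`
  have hπ : (A / ((4 * (L : ℝ) + 1) ^ 2 * ((L : ℝ) + 1) ^ 3)) ^ (1 / (2 * (L : ℝ))) ≤ tubePolygonRate 2 1 L :=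
    (Real.rpow_le_rpow hB0.le hApoly (by positivity)).trans hrate
  have hπ0 : 0 < tubePolygonRate 2 1 L := lt_of_lt_of_le (by positivity) hπ
  have hlog := Real.log_le_log (by positivity) hπ
  rw [Real.log_rpow hB0] at hlog
  have e1 : ((L - 1 : ℕ) : ℝ) = (L : ℝ) - 1 := by rw [Nat.cast_sub hL1]; push_cast; ring
  have e2 : ((2 * (L - 1) : ℕ) : ℝ) = 2 * (L : ℝ) - 2 := by push_cast [Nat.cast_sub hL1]; ring
  have hval : Real.log (A / ((4 * (L : ℝ) + 1) ^ 2 * ((L : ℝ) + 1) ^ 3)) =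
      (2 * (L : ℝ) - 2) * Real.log (Zd.connectiveConstant 2) - C * Real.sqrt ((L : ℝ) - 1)
        - 2 * Real.log (4 * (L : ℝ) + 1) - 3 * Real.log ((L : ℝ) + 1) := by
    have h4 : (0 : ℝ) < (4 * (L : ℝ) + 1) ^ 2 := by positivity
    have h5 : (0 : ℝ) < ((L : ℝ) + 1) ^ 3 := by positivity
    rw [Real.log_div hA0.ne' (mul_pos h4 h5).ne', Real.log_mul h4.ne' h5.ne', Real.log_pow, Real.log_pow, hA,
      Real.log_mul (by positivity) (Real.exp_pos _).ne', Real.log_pow, Real.log_exp, e1, e2]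
    push_cast
    ring
  rw [hval] at hlog
  refine le_trans (le_of_eq ?_) hlog
  ring

/-! ### Elementary estimates -/

/-- `log x ≤ 2√x` for `x > 0`. [folklore] -/
private theorem log_le_two_sqrt {x : ℝ} (hx : 0 < x) : Real.log x ≤ 2 * Real.sqrt x := by
  have h := Real.log_le_sub_one_of_pos (Real.sqrt_pos.2 hx)
  rw [Real.log_sqrt hx.le] at h
  linarith [Real.sqrt_nonneg x]

/-- `√(4L+1) ≤ 3√L` for `L ≥ 1`. [folklore] -/
private theorem sqrt_four_mul_add_one_le {L : ℝ} (hL : 1 ≤ L) : Real.sqrt (4 * L + 1) ≤ 3 * Real.sqrt L := by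
  rw [show 3 * Real.sqrt L = Real.sqrt (9 * L) by
    rw [Real.sqrt_mul (by norm_num), show (9 : ℝ) = 3 ^ 2 by norm_num, Real.sqrt_sq (by norm_num)]]
  exact Real.sqrt_le_sqrt (by linarith)

/-- `√(L+1) ≤ (3/2)√L` for `L ≥ 1`. [folklore] -/
private theorem sqrt_add_one_le {L : ℝ} (hL : 1 ≤ L) : Real.sqrt (L + 1) ≤ (3 / 2) * Real.sqrt L := by
  rw [show (3 / 2) * Real.sqrt L = Real.sqrt ((9 / 4) * L) by
    rw [Real.sqrt_mul (by norm_num), show (9 / 4 : ℝ) = (3 / 2) ^ 2 by norm_num, Real.sqrt_sq (by norm_num)]]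
  exact Real.sqrt_le_sqrt (by linarith)

/-- The numerator bound: for `L ≥ 1`, `m ≥ 0`, `C ≥ 0`,
`2m + C√L + 2 log(4L+1) + 3 log(L+1) ≤ 2√L (m + C/2 + 11)` (any real `C`). [folklore] -/
private theorem numerator_le {L m C : ℝ} (hL : 1 ≤ L) (hm : 0 ≤ m) :
    2 * m + C * Real.sqrt L + 2 * Real.log (4 * L + 1) + 3 * Real.log (L + 1) ≤
      2 * Real.sqrt L * (m + C / 2 + 11) := by
  have hs1 : 1 ≤ Real.sqrt L := by rw [← Real.sqrt_one]; exact Real.sqrt_le_sqrt hL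
  have h1 : Real.log (4 * L + 1) ≤ 6 * Real.sqrt L := by
    have := log_le_two_sqrt (show 0 < 4 * L + 1 by linarith)
    linarith [sqrt_four_mul_add_one_le hL]
  have h2 : Real.log (L + 1) ≤ 3 * Real.sqrt L := by
    have := log_le_two_sqrt (show 0 < L + 1 by linarith)
    linarith [sqrt_add_one_le hL]
  nlinarith

/-! ### The CEILING -/

/-- **`PolygonStripLocality`** with the explicit constant `C' = log μ + C⁺/2 + 11` (`C⁺ = max C 0`, `C` the
constant of Madras–Slade Cor. 3.2.5): `log μ − log π(S_L) ≤ C'/√L` for every `L ≥ 1`.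
[cite: MadrasSlade1993, §8.2, Theorem 8.2.1, eq. (8.2.12) (locality; quantitative form for polygons in planar strips, this file)] -/
theorem polygonStripLocality_explicit {C : ℝ}
    (hC : ∀ M : ℕ, 1 ≤ M → Zd.connectiveConstant 2 ^ (2 * M) * Real.exp (-(C * Real.sqrt M)) ≤
      (Zd.countAt 2 (2 * M + 1) Zd.eDown : ℝ)) (L : ℕ) (hL : 1 ≤ L) :
    Real.log (Zd.connectiveConstant 2) - Real.log (tubePolygonRate 2 1 L) ≤
      (Real.log (Zd.connectiveConstant 2) + max C 0 / 2 + 11) / Real.sqrt L := by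
  have hμ1 : 1 ≤ Zd.connectiveConstant 2 := Zd.one_le_connectiveConstant 2
  have hlogμ : 0 ≤ Real.log (Zd.connectiveConstant 2) := Real.log_nonneg hμ1
  have hLr : (1 : ℝ) ≤ L := by exact_mod_cast hL
  have hsL : 0 < Real.sqrt L := Real.sqrt_pos.2 (by linarith)
  have hs1 : 1 ≤ Real.sqrt (L : ℝ) := by rw [← Real.sqrt_one]; exact Real.sqrt_le_sqrt hLr
  have hC0 : 0 ≤ max C 0 := le_max_right _ _
  rcases (show L = 1 ∨ 2 ≤ L by omega) with h1 | h2
  · -- `L = 1`: `log π(S_1) ≥ 0`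
    subst h1
    have hπ := Real.log_nonneg (one_le_tubePolygonRate (L := 1) le_rfl)
    rw [le_div_iff₀ hsL]
    simp only [Nat.cast_one, Real.sqrt_one, mul_one]
    linarith
  · -- `L ≥ 2`: the chain bound with `C⁺` in place of `C`
    have hC' : ∀ M : ℕ, 1 ≤ M → Zd.connectiveConstant 2 ^ (2 * M) * Real.exp (-(max C 0 * Real.sqrt M)) ≤
        (Zd.countAt 2 (2 * M + 1) Zd.eDown : ℝ) := by
      intro M hM
      refine le_trans (mul_le_mul_of_nonneg_left (Real.exp_le_exp.2 ?_) (by positivity)) (hC M hM)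
      have := Real.sqrt_nonneg (M : ℝ)
      nlinarith [le_max_left C 0]
    have hM := hC' (L - 1) (by omega)
    rw [show 2 * (L - 1) + 1 = 2 * L - 1 by omega] at hM
    have hmain := log_rate_ge h2 hM
    have hL0 : (0 : ℝ) < L := by linarith
    -- `√(L-1) ≤ √L`
    have hsq : Real.sqrt ((L : ℝ) - 1) ≤ Real.sqrt L := Real.sqrt_le_sqrt (by linarith)
    have hnum := numerator_le (C := max C 0) hLr hlogμ
    -- combine
    rw [le_div_iff₀ hsL]
    have hkey : (Real.log (Zd.connectiveConstant 2) - Real.log (tubePolygonRate 2 1 L)) * (2 * (L : ℝ)) ≤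
        2 * Real.log (Zd.connectiveConstant 2) + max C 0 * Real.sqrt L + 2 * Real.log (4 * L + 1) +
          3 * Real.log ((L : ℝ) + 1) := by
      have := mul_le_mul_of_nonneg_right hmain (show (0 : ℝ) ≤ 2 * L by positivity)
      rw [div_mul_cancel₀ _ (by positivity)] at this
      nlinarith [mul_nonneg hC0 (sub_nonneg.2 hsq)]
    -- `X · 2L ≤ 2√L · C'` ⇒ `X · √L ≤ C'` using `L = √L · √L`
    have hLL : (L : ℝ) = Real.sqrt L * Real.sqrt L := (Real.mul_self_sqrt hL0.le).symm
    nlinarith [hkey, hnum, hLL, hsL]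

/-- **`PolygonStripLocality`** (the typed target): `∃ C, ∀ L ≥ 1, log μ − log π(S_L) ≤ C/√L`.
[cite: MadrasSlade1993, §8.2, Theorem 8.2.1, eq. (8.2.12) (locality; quantitative form for polygons in planar strips, this file)] -/
theorem polygonStripLocality : ∃ C : ℝ, ∀ L : ℕ, 1 ≤ L →
    Real.log (Zd.connectiveConstant 2) - Real.log (tubePolygonRate 2 1 L) ≤ C / Real.sqrt L := by
  obtain ⟨C, hC⟩ := Zd.MadrasSlade1993_cor325_lower
  exact ⟨_, fun L hL => polygonStripLocality_explicit hC L hL⟩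

end

end Literature.Probability.RandomPlanarGeometry.SAW.Zd.StripPolygon

/-! ### Part E — the sharp eventual constant `π√(2/3)` and the free WALK corollary -/

namespace Literature.Probability.RandomPlanarGeometry.SAW.Zd.StripPolygon

open Filter _root_.Topology Finset
open Literature.Probability.LatticeModels (Site zdGraph)
open Literature.Probability.RandomPlanarGeometry.SAW
open scoped BigOperators

noncomputable section

/-- `(A + 5 log L)/√L → 0`. [folklore] -/
private theorem tendsto_const_add_log_div_sqrt (A : ℝ) :
    Tendsto (fun L : ℕ => (A + 5 * Real.log (L : ℝ)) / Real.sqrt (L : ℝ)) atTop (𝓝 0) := by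
  have hnat : Tendsto (fun L : ℕ => (L : ℝ)) atTop atTop := tendsto_natCast_atTop_atTop
  have hsqrt : Tendsto (fun L : ℕ => Real.sqrt (L : ℝ)) atTop atTop := Real.tendsto_sqrt_atTop.comp hnat
  have h1 : Tendsto (fun L : ℕ => A / Real.sqrt (L : ℝ)) atTop (𝓝 0) := by
    have h := (tendsto_inv_atTop_zero.comp hsqrt).const_mul A
    rw [mul_zero] at h
    exact h.congr fun L => by simp [div_eq_mul_inv]
  have h2 : Tendsto (fun L : ℕ => 5 * (Real.log (L : ℝ) / Real.sqrt (L : ℝ))) atTop (𝓝 0) := by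
    have hlo := (isLittleO_log_rpow_atTop (by norm_num : (0 : ℝ) < 1 / 2)).tendsto_div_nhds_zero
    have hlo' : Tendsto (fun x : ℝ => Real.log x / Real.sqrt x) atTop (𝓝 0) := by
      refine hlo.congr' ?_
      filter_upwards [eventually_ge_atTop 0] with x hx
      rw [Real.sqrt_eq_rpow]
    simpa using (hlo'.comp hnat).const_mul 5
  have hsum := h1.add h2
  rw [add_zero] at hsum
  refine hsum.congr fun L => ?_
  rw [add_div, mul_div_assoc]

/-- **POL-LOC with the sharp leading constant**: for every `η > 0`, for all sufficiently large `L`,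
`log μ − log π(S_L) ≤ (π√(2/3) + η)/√L` (from the sharp Cor. 3.2.5 `Zd.MadrasSlade1993_cor325_lower_sharp`;
the pieces of the chain have height `≤ L`, which is why the bridge constant `2π√(2/3)` is halved).
[cite: MadrasSlade1993, §8.2, Theorem 8.2.1, eq. (8.2.12); Corollary 3.2.5 (sharp constant; this file)] -/
theorem polygonStripLocality_eventually {η : ℝ} (hη : 0 < η) :
    ∀ᶠ L : ℕ in atTop, Real.log (Zd.connectiveConstant 2) - Real.log (tubePolygonRate 2 1 L) ≤
      (Real.pi * Real.sqrt (2 / 3) + η) / Real.sqrt L := by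
  set c : ℝ := Real.pi * Real.sqrt (2 / 3) with hc
  have hc0 : 0 ≤ c := by positivity
  obtain ⟨M₀, hM₀⟩ := Zd.MadrasSlade1993_cor325_lower_sharp (C := 2 * c + η) (by rw [hc]; linarith)
  have hμ1 : 1 ≤ Zd.connectiveConstant 2 := Zd.one_le_connectiveConstant 2
  have hlogμ : 0 ≤ Real.log (Zd.connectiveConstant 2) := Real.log_nonneg hμ1
  set A : ℝ := 2 * Real.log (Zd.connectiveConstant 2) + 2 * Real.log 5 + 3 * Real.log 2 with hA
  have hev := (tendsto_const_add_log_div_sqrt A).eventually (Iio_mem_nhds hη)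
  filter_upwards [hev, eventually_ge_atTop (M₀ + 2)] with L hf hL
  have hf : (A + 5 * Real.log (L : ℝ)) / Real.sqrt (L : ℝ) < η := hf
  have hL2 : 2 ≤ L := by omega
  have hLr : (2 : ℝ) ≤ L := by exact_mod_cast hL2
  have hs : 0 < Real.sqrt (L : ℝ) := Real.sqrt_pos.2 (by linarith)
  -- the chain bound at `M = L - 1 ≥ M₀`
  have hM := hM₀ (L - 1) (by omega)
  rw [show 2 * (L - 1) + 1 = 2 * L - 1 by omega] at hM
  have hmain := log_rate_ge hL2 hM
  have hX : (Real.log (Zd.connectiveConstant 2) - Real.log (tubePolygonRate 2 1 L)) * (2 * (L : ℝ)) ≤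
      2 * Real.log (Zd.connectiveConstant 2) + (2 * c + η) * Real.sqrt ((L : ℝ) - 1) +
        2 * Real.log (4 * (L : ℝ) + 1) + 3 * Real.log ((L : ℝ) + 1) := by
    have := mul_le_mul_of_nonneg_right hmain (show (0 : ℝ) ≤ 2 * L by positivity)
    rw [div_mul_cancel₀ _ (by positivity)] at this
    linarith
  -- elementary comparisons
  have hsq : Real.sqrt ((L : ℝ) - 1) ≤ Real.sqrt L := Real.sqrt_le_sqrt (by linarith)
  have hl1 : Real.log (4 * (L : ℝ) + 1) ≤ Real.log 5 + Real.log L := by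
    rw [← Real.log_mul (by norm_num) (by linarith)]
    exact Real.log_le_log (by linarith) (by linarith)
  have hl2 : Real.log ((L : ℝ) + 1) ≤ Real.log 2 + Real.log L := by
    rw [← Real.log_mul (by norm_num) (by linarith)]
    exact Real.log_le_log (by linarith) (by linarith)
  have hf' : A + 5 * Real.log (L : ℝ) ≤ η * Real.sqrt L := by
    rw [div_lt_iff₀ hs] at hf; linarith
  have hcη : (2 * c + η) * Real.sqrt ((L : ℝ) - 1) ≤ (2 * c + η) * Real.sqrt L :=
    mul_le_mul_of_nonneg_left hsq (by linarith)
  have hY : (Real.log (Zd.connectiveConstant 2) - Real.log (tubePolygonRate 2 1 L)) * (2 * (L : ℝ)) ≤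
      (2 * c + 2 * η) * Real.sqrt L := by
    have hA' : 2 * Real.log (Zd.connectiveConstant 2) + 2 * Real.log (4 * (L : ℝ) + 1) + 3 * Real.log ((L : ℝ) + 1)
        ≤ A + 5 * Real.log (L : ℝ) := by rw [hA]; linarith
    nlinarith [hX, hcη, hA', hf']
  rw [le_div_iff₀ hs]
  have h3 : (Real.log (Zd.connectiveConstant 2) - Real.log (tubePolygonRate 2 1 L)) * Real.sqrt L * (2 * Real.sqrt L)
      ≤ (c + η) * (2 * Real.sqrt L) := by
    have e : (Real.log (Zd.connectiveConstant 2) - Real.log (tubePolygonRate 2 1 L)) * Real.sqrt L * (2 * Real.sqrt L)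
        = (Real.log (Zd.connectiveConstant 2) - Real.log (tubePolygonRate 2 1 L)) * (2 * (L : ℝ)) := by
      have h2 : Real.sqrt (L : ℝ) * Real.sqrt L = L := Real.mul_self_sqrt (by linarith)
      linear_combination (2 * (Real.log (Zd.connectiveConstant 2) - Real.log (tubePolygonRate 2 1 L))) * h2
    rw [e]; linarith
  exact le_of_mul_le_mul_right h3 (by positivity)

/-- **The WALK corollary** (`π(S_L) ≤ μ(S_L)`): `log μ − log μ(S_L) ≤ log μ − log π(S_L)` for `L ≥ 1`. [folklore] -/
private theorem log_sub_log_tube_le_log_sub_log_rate {L : ℕ} (hL : 1 ≤ L) :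
    Real.log (Zd.connectiveConstant 2) - Real.log (Zd.tubeConnectiveConstant 2 1 L) ≤
      Real.log (Zd.connectiveConstant 2) - Real.log (tubePolygonRate 2 1 L) := by
  have h1 := one_le_tubePolygonRate hL
  have h := Real.log_le_log (by linarith) (tubePolygonRate_le_tubeConnectiveConstant L)
  linarith

/-- **Planar strip locality of `μ` via polygons, explicit**: `log μ − log μ(S_L) ≤ (log μ + C⁺/2 + 11)/√L`, `L ≥ 1`.
[cite: MadrasSlade1993, §8.2, Theorem 8.2.1, eq. (8.2.12) (quantitative form, planar strips, this file)] -/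
theorem stripLocality_explicit {C : ℝ}
    (hC : ∀ M : ℕ, 1 ≤ M → Zd.connectiveConstant 2 ^ (2 * M) * Real.exp (-(C * Real.sqrt M)) ≤
      (Zd.countAt 2 (2 * M + 1) Zd.eDown : ℝ)) (L : ℕ) (hL : 1 ≤ L) :
    Real.log (Zd.connectiveConstant 2) - Real.log (Zd.tubeConnectiveConstant 2 1 L) ≤
      (Real.log (Zd.connectiveConstant 2) + max C 0 / 2 + 11) / Real.sqrt L :=
  (log_sub_log_tube_le_log_sub_log_rate hL).trans (polygonStripLocality_explicit hC L hL)

/-- **Planar strip locality of `μ` with the constant `π√(2/3)`** — HALF the bridge-scheme constant `2π√(2/3)` of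
the tree's `Zd.eventually_log_sub_log_tubeConnectiveConstant_le` (case `d = 2`, `k = 1`): for every `η > 0`, for all
sufficiently large `L`, `log μ − log μ(S_L) ≤ (π√(2/3) + η)/√L`.
[cite: MadrasSlade1993, §8.2, Theorem 8.2.1, eq. (8.2.12); §3.1 eq. (3.1.7) (leading constant halved via polygons, this file)] -/
theorem stripLocality_eventually {η : ℝ} (hη : 0 < η) :
    ∀ᶠ L : ℕ in atTop, Real.log (Zd.connectiveConstant 2) - Real.log (Zd.tubeConnectiveConstant 2 1 L) ≤
      (Real.pi * Real.sqrt (2 / 3) + η) / Real.sqrt L := by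
  filter_upwards [polygonStripLocality_eventually hη, eventually_ge_atTop 1] with L h hL
  exact (log_sub_log_tube_le_log_sub_log_rate hL).trans h

end

end Literature.Probability.RandomPlanarGeometry.SAW.Zd.StripPolygon
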